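import Mathlib
import HarnessLib
import HarnessLib.Audit
import Summits.AtomisticToContinuum.Statement
import Literature.Analysis.FluidPDE.HardSphereCollisionRecord
import Summits.AtomisticToContinuum.HydrodynamicLimit.Theorems.ImplosionDichotomyHsEosLowDensity
import HarnessLib.Audit.Status.Attr

/-!
Route: InformationPercolationEngine

DORMANT since 2026-08-24T07:09:28Z (reconciler: no traction for 6.6 d (last activity item-evidence-added at 2026-08-17T16:40:18Z); parked, not closed — `ledger route dormant route-AtomisticToContinuum-InformationPercolationEngine --off`) — unstaffed, not closed; items shared with open routes are served there. `ledger route dormant <id> --off` reactivates.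

# Route InformationPercolationEngine — information percolation on the collision DAG — kicks as fair
as in equilibrium given the coarse past + subcritical χ²-dilution (2λ₂² < 1) give molecular chaos at
contact at fixed density, and chaos closes Euler

It suffices to show X = ContactChaos ∧ CollisionRate: at every fixed, small reduced density σ, under
local Gibbs data, the normalised empirical COLLISION measure of the deterministic hard-sphere flow
factorises in the limit N → ∞ into the flux-weighted product of the local one-particle law
(ContactChaos, the target) with the Enskog contact rate σ³Y(σ³ρ) (CollisionRate, crux #5) — because
the kinetic dock ChaosClosesEuler (crux #7, ledger rank 10, rev 8: chaos + rate + the admissibility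
LocalSecondLaw (crux #6) ⇒ the packing-guarded conjunct — since the statement re-type of 2026-08-16
(D-0032, p126922; route rev 15) VERBATIM the sub-problem decl `HydrodynamicLimit` itself (∃ η₀ > 0
outermost; classical hs-Euler solutions with ρ_t(x)σ³ < η₀ on [0,T); formerly the shared item
HydroLimitInBand, stmt-9133), with the tail input CollisionMomentBound filed as a support and the
dock-with-tails KineticDock recorded as its first stub; Bogolyubov's exact hierarchy for the
empirical pair ⇒ Maxwellian rigidity ⇒ hs-Euler momentum flux incl. the truncated collisional
transfer ⇒ Březina–Feireisl weak–strong stability) carries X to the conjunct; the guard-removal crux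
DiluteSelfConsistency (#8 of revs 8–14, consumed only while the conjunct was the UNGUARDED
Literature conjecture) is moot for the guarded Statement and was dropped from this route at rev 15
(it lives on as the shared item stmt-3091). Since rev 8 (crux-only deciding theorem, human ruling
2026-08-16) every unproved hypothesis of `closes` is a ranked crux; the only support it consumes is
the PROVED HsEosLowDensity, inside the dock. The route is a MECHANISM for the target, realising card
information-percolation-collision-dag (spine; conforming D-0027 successor of the retired route
InformationPercolation, now with a deciding theorem and with the engine TYPED over the landed
collision-record / collision-DAG vocabulary
`Literature.Analysis.FluidPDE.HardSphereCollisionRecord`): treat the backward collision DAG of the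
flow as a noisy network whose node noise is the impact vector of each collision — distributed, given
the coarse past of all spheres, AS UNDER THE INVARIANT GIBBS LAW (flux-uniform off the caps shielded
by visible adjacent bodies), uniformly over past-measurable weights (crux 2
KickFairRelEquilibriumMeso, rev 12: each kick test is centred at its equilibrium conditional mean
given the same past, and the past is read at a MESOSCOPIC position scale r_N → 0 with (N+1)·r_N³ →
∞, i.e. ε ≪ r_N ≪ 1, so the past never pins a kick; two earlier typings are held under negative
lemmas — the absolute form KickIsotropyInfo of revs 1–3 (third-body shielding: an equilibrium
node-channel memory of relative order φ) and the fixed-cell relative form of revs 4–11, decl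
KickFairRelEquilibrium (sub-cell clustering of the collision point with unresolved third bodies: a
relative defect ≍ φ·r²|∇log ρ|², N-independent at fixed cell size r, vanishing as r → 0) — each
re-types the node channel without removing the network) — and whose edge channel, the hard-sphere
jump operator, contracts χ²-information by λ₂² < 1/2 per collision while lineages branch by 2 (crux
3 SpectralContractionR — over MEASURABLE mean-zero test functions; rev 3 repair of the rev-2 decl
SpectralContraction, refuted-misstated by a non-measurable Bochner-junk witness): information shared
through common ancestry is then summable over ALL depths (Kesten–Stigum side 2λ₂² < 1), so pair
statistics at contact have finite memory in collision generations, uniformly in N, while conserved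
means are transmitted exactly critically (2λ₁ = 1) and persist — "Euler lives on the Kesten–Stigum
line"; the contact law is therefore a function of the local conserved fields only, i.e. the
equilibrium (product, Enskog) law: crux 4 PercolationClosesChaos is that implication,
KickFairRelEquilibriumMeso → SpectralContractionR → ContactChaos.
Lean: `ContactChaos ∧ CollisionRate`

## Assembly
Pure logic, PROVED sorry-free as `theorem closes` in glue.lean (rev 15 = the rev-12 crux-only form
minus the guard removal, after the statement re-type hydro2: 6 hypotheses
KickFairRelEquilibriumMeso, SpectralContractionR, PercolationClosesChaos, CollisionRate,
LocalSecondLaw, ChaosClosesEuler; proof term `hC (hP hK hS) hR hL`; farm-checked rc 0 inside the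
gate-rendered route file, axioms propext / Classical.choice / Quot.sound): PercolationClosesChaos
applied to KickFairRelEquilibriumMeso and SpectralContractionR yields ContactChaos (the target,
derived not assumed); ChaosClosesEuler applied to ContactChaos, CollisionRate, LocalSecondLaw yields
the packing-guarded conjunct with its threshold η₀ — which IS `HydrodynamicLimit` (the sub-problem
decl) verbatim since the re-type, so no guard is discharged and DiluteSelfConsistency is no longer a
hypothesis (revs 8–14: seventh hypothesis, σ₀ := min of two thresholds). SpectralContractionR is
PROVED (2026-08-16T13:14Z) but stays a hypothesis: its proof file imports this route file, so no
`_holds` link can be rendered without an import cycle; it is discharged when the summit is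
assembled. The Assembly ITEM is, from rev 16, the frame statement #1 `X → Statement` with X the Lean
line of the chain MINUS the dock: KickFairRelEquilibriumMeso → SpectralContractionR →
PercolationClosesChaos → CollisionRate → LocalSecondLaw → HydrodynamicLimit — implied by
ChaosClosesEuler by one line of logic (`fun hK hS hP hR hL => hC (hP hK hS) hR hL`, farm-checked in
the planner's Sketch.lean) and provable the moment the dock is; the rev-15 Assembly (stmt-17601)
carried the dock itself as a sixth antecedent, was therefore a tautology modulo unfolding and was
closed by the gate's ground battery (`intros; aesop`, ground.trivial) — the one blocking ground flag
of rev 15, removed by this restatement (same battery on the new statement: no flag).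

Rationale: WHY THIS LINE. Broadcasting on trees and strong data-processing on Bayesian networks (EvansEtAl2000,
Kesten–Stigum bλ₂² = 1; PolyanskiyWu2017 §5
"percolation of information"; PolyanskiyWu2024 Ch. 33) bound what two leaves share through common
ancestors by a sum over ancestor
path pairs of products of per-edge contraction coefficients; transplanted with the dictionary leaf ↦
incoming velocity of a collision
partner, node ↦ collision, node noise ↦ impact vector given the coarse past
(`HardSphereFlow.coarsePastOf`), edge channel ↦ the jump
operator K of a tagged sphere in a Maxwellian bath (doi:10.3934/krm.2008.1.521,
doi:10.1016/j.jfa.2015.05.002), branching ↦ 2,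
path pairs ↦ `pathPairCount`, it yields chaos at contact from DILUTION of shared information instead
of DISJOINTNESS of collision
histories — the logic of every validity proof in print (Lanford1975, GST2013,
PulvirentiSimonella2016, BGSSAnnals2023, DengHaniMa2024;
collision trees doi:10.3934/krm.2018008), void after ≍ log N collisions and a fortiori at fixed
density where each sphere collides
≍ N^{1/3} times per unit time. Imported areas: information theory (SDPI, information percolation),
spectral theory of the linear
Boltzmann operator, hyperbolic billiards only through the kick crux KickFairRelEquilibriumMeso
(doi:10.1090/surv/127 Ch. 5, 7: u-conditionals, standard pairs), hyperbolic
conservation laws for the closure (BrezinaFeireisl2018). Versus the board: OneFlightGossipEngine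
posits kick isotropy (its informal
B1′ is the sibling of this route's kick crux — typed here for the first time, since rev 4 in the
equilibrium-relative form that survives third-body shielding and since rev 12 in the MESOSCOPIC
relative form KickFairRelEquilibriumMeso that also survives sub-cell clustering) and spends it
on equilibrium variance decay inside kinetic windows;
HeatBathForgetting / KineticWindows-type routes need forgetting over FINITE windows; here forgetting
is over all N^{1/3}t generations
with an explicit threshold; BoxDissipativeWeakStrong and the retired CollisionMeasureChaos CONSUME
chaos (FluxClosure / ContactChaos)
without a mechanism — this route supplies one and re-files the latter's typed closure items verbatim
(identical signatures, so any consumer shares them).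
REV 3 (repair, 2026-08-15): the per-edge constant is asked over MEASURABLE test functions
(SpectralContractionR) after the rev-2 decl SpectralContraction (stmt-13479) fell to a
non-measurable Bochner-junk witness (refuted-misstated,
Theorems.InformationPercolationEngineSpectralContraction_refuted @ 1aef2ab59ca9);
PercolationClosesChaos and Assembly re-filed over it; thesis, mechanism, dictionary, deciding
theorem unchanged.
REV 4 (route-choice, 2026-08-16): crux 2 KickIsotropyInfo (stmt-13478) is HELD under the negative
lemma Theorems.KickIsotropyInfoNegative.KickIsotropyInfo_false_of_ShieldingBiasPersists (p84825) —
absolute flux-fairness given the two-snapshot past is false at relative order φ already under the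
INVARIANT law (third-body shielding; MD kit j004861, cartoon j005475; ChapmanCowling1970 §16.21), H
unconstructible only for want of Palm calculus for collision sums. Choice: RESTATE (shielding is a
one-generation, O(φ)-stratum, equilibrium-present memory: it re-types the node channel and leaves
dilution over depth, 2λ₂² < 1 and equilibrium identification untouched): crux 2 becomes
KickFairRelEquilibrium (four planner seats + both triagers, Cruxes/KickIsotropyInfo/Ideas/*.md,
TRIAGE-r1-1/2); PercolationClosesChaos and Assembly re-filed over it, engine re-read shield-aware,
`closes` re-certified.
REV 6 (judge-repair, 2026-08-16; D-0031 pass 06:45Z: tier C, what_would_move_it 'KickIsotropyInfo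
restated, vetted, surviving; certified λ₂²<1/2'): RESTATED = rev 5; VETTED = refute-pool g48-2
06:50Z (survives, XL; Borel-measurability of the good-set-cut past map load-bearing for condExp);
SURVIVING = no kill on file; CERTIFIED λ₂² < 1/2 = the c = 1/4 Lean line of #3. Badge/barrier text
only.
REV 8 (route-repair rbadge, 2026-08-16; gate stamp glue.non-crux-hypothesis — human ruling of the
same day: `closes` may assume CRUX items only, proved items are used through `_holds`): the closure
half is re-cut so that EVERY unproved hypothesis of `closes` is a ranked crux and nothing open hides
as support. CollisionRate (13481), LocalSecondLaw (13081), DiluteSelfConsistency (3091) are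
re-badged crux (open problems by every audit on file; cruxes in JParityClosure / ImplosionLoophole /
OneFlightGossipEngine); the dock KineticClosure (13482) is DROPPED after FOUR independent prover
verdicts 'refuted-misstated / not closable as filed' (velocity-tail gap: bounded-mark chaos cannot
close the collisional momentum transfer; evidence-13482-*.md, KineticClosureGen2/3.lean) and
replaced by the crux ChaosClosesEuler (#7, ContactChaos → CollisionRate → LocalSecondLaw →
HydroLimitInBand, stmt-9133 verbatim) whose recorded two-layer plan makes the gap explicit —
CollisionMomentBound (second velocity moments of K_N tight: the tail input; FILED as a support at
rev 10 because a planner-side --split is final-cycle-only) and KineticDock (the dock WITH the tail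
antecedent, the crux's first stub), glue CollisionMomentBound → KineticDock → ChaosClosesEuler by
pure logic — with DiluteSelfConsistency moved into `closes` as the guard removal
(Box/Annealed/JParity pattern), the proved HsEosLowDensity consumed inside the dock, DensityCap kept
as support (bootstrapped inside the dock, fallback input). `closes` re-proved crux-only over the 7
cruxes (Sketch.lean rc 0, standard axioms): 3 engine nodes + CollisionRate + LocalSecondLaw +
ChaosClosesEuler + DiluteSelfConsistency — 'engine ∘ kinetic closure' (the closure half is shared in
substance with LimitCollisionMeasure 13350–13356, a parallel typing; bridge lemmas are a tenure
task). On `SpectralContractionR_holds` (5/6 stubs landed) a tenure edit drops hS.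
REV 12 (route-choice rchoice, 2026-08-16, negative-lemma hold on crux 2): KickFairRelEquilibrium
(stmt-14914) is HELD under Theorems.KickFairRelEquilibriumNegative.
KickFairRelEquilibrium_false_of_SubcellClusteringBiasPersists (H → ¬decl, sorry-free; H =
SubcellClusteringBiasPersists: with a pure activity tilt dLG/dG = Z⁻¹∏a₀(x_k(0)) exactly, so the
defect of the compensated sum is the G-conditional covariance, GIVEN THE TYPED PAST, of the
sub-cell tilt with the kick; first order in the sub-cell displacement vanishes, second order
survives: the collision point (∝ ρ² in its cell under LG, uniform under G) is co-located with the
UNRESOLVED third bodies (∝ ρ), clustering factor 1 + r²|∇log ρ|²/6, acting on the O(φ)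
tube-overlap part B_U of the conditional kick bias ⇒ E_LG[g|P] − κ(P) ≈ (r²|∇log ρ|²/6)·B_U,
N-INDEPENDENT at fixed r; dynamics-free cartoon kit j017199: E_Palm[B_U] = −0.00174(3) for the Lean
zonal test at φ = 0.05, relative defect ≈ 7·10⁻⁴·(r|∇log a₀|)² — false by a hair at every σ, ∝ r²;
H unconstructible for want of collision-rate / Palm–Campbell identities of the N-body flow and of
the positive-time local-equilibrium fine structure). CLASS misstated by the disprover (Disproof
F2), by the r1 memo Cruxes/KickFairRelEquilibrium/Analysis-r1-k1.md §C/§E and by the line lead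
(PICKED.md) alike, with two repairs on file: R1 = the quantifier shape of ContactChaos (∀δ ∃r₀ ∀r<r₀
∃N₀), R2 = mesoscopic cells r_N → 0 with ε ≪ r_N ≪ (ℓv̄τ)^{1/2} ≍ N^{-1/6}. CHOICE: RESTATE per R2,
in ∃-form — crux 2 becomes KickFairRelEquilibriumMeso := ∃ rs : ℕ → ℝ, rs > 0, rs → 0, (N+1)·rs³ →
∞ (⟺ ε ≪ rs N at every fixed σ: the past never pins a kick) ∧ [the rev-4 body verbatim with cells
`Torus.coarseCell (rs N)` and no ∀ r]. WHY NOT R1: under R1 the decl is plausibly true but part (b)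
has NO line — at every fixed r sub-cell hydrodynamic modes invisible to the typed past cost only
e^{−cNa²} under G and bias the centred kicks by ≍ φa², a speed-N large-deviation LOWER bound
(Disproof
F3 `stubEqKickTail_false_of_subcellModeTailLowerBound`, memo §D) that voids every G-referenced
transfer, the line's LANDED density domination p96578 (LG ≤ Λ^{N+1}G_{θ₁}) and the entropy
inequality alike; below r_N ≪ N^{-1/6} such modes live only r_N²/(ℓv̄) ≪ τ, so in the window BOTH
halves keep their lines. WHY ∃ AND ONLY THE LOWER EDGE: the kick prover picks the sequence (default
(N+1)^{-1/4}, the geometric middle of the window at every σ); the engine PercolationClosesChaos,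
re-filed over the new decl, must run on ANY admissible sequence and uses only rs → 0 and ε/rs → 0
(kernel κ^G flux-uniform off shields up to O(ε/rs); depth-1 conditioning finer, still
non-pinning); genuine mechanisms (an rs-independent evolved/equilibrium gap, non-summable centred
correlations) still refute it, scale artefacts no longer do. WHY NOT WAIT: H is the physical
prediction, expected TRUE — waiting is a slow refutation of a typing nobody defends. WHY NOT
ABANDON: the defect is one mesoscopic bookkeeping level above the kick (where in the cell the
collision sits, not how the kick is distributed given the local geometry), vanishes in the very
limit ContactChaos takes (N → ∞ then r → 0), and leaves dilution, 2λ₂² < 1 (5/6 stubs landed) and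
equilibrium identification untouched. Re-filed over the new decl: PercolationClosesChaos (14915 →
new item, same name) and Assembly (15140, proved → new item); `closes` re-proved verbatim with hK :
KickFairRelEquilibriumMeso (folder Sketch.lean rc 0, axioms propext / Classical.choice /
Quot.sound; window inhabited by (N+1)^{-1/4}, checked in the same file). Second and LAST recorded
deviation from kill criterion (ii) — see there.
REV 15 (route-repair, statement re-type hydro2, p126922, 2026-08-16T21:32Z): the sub-problem decl
`_root_.HydrodynamicLimit` — until then an abbrev of the UNGUARDED Literature conjecture — became
the
PACKING-GUARDED conjunct (∃ η₀ > 0 outermost; classical solutions with ρ_t(x)σ³ < η₀ on [0,T)),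
verbatim the
d = 3 body of `HydroLimitInBandDim` (`hydroLimitInBandDim_three_iff_root`; the old conjunct still
implies it,
`HydrodynamicLimit.of_unguarded`) and hence VERBATIM the conclusion of the dock ChaosClosesEuler
(#7). All
consequences are bookkeeping: `closes` is re-proved as the one-line term `hC (hP hK hS) hR hL` over
SIX crux
hypotheses (KickFairRelEquilibriumMeso, SpectralContractionR, PercolationClosesChaos, CollisionRate,
LocalSecondLaw, ChaosClosesEuler; farm-checked rc 0 inside the gate-rendered file, axioms propext /
Classical.choice / Quot.sound); the guard removal DiluteSelfConsistency (#8 of revs 8–14, stmt-3091)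
is no
longer consumed by anything here and is DROPPED from this route (it stays the shared item of ~40
routes and
now bears only on the stronger unguarded Literature conjecture); the Assembly item is re-filed as
the six-crux
chain. SpectralContractionR (#3) is PROVED (closed 2026-08-16T13:14Z by
Cruxes.SpectralContractionR.SwapSymmetrisation.SpectralContractionR_proof) and remains a hypothesis
of `closes`:
its proof file imports this route file, so the gate cannot render a `_holds` link without an import
cycle —
the 'drop hS' tenure edit foreseen at rev 8 is neither available nor needed (a proved crux is
discharged when
the summit is assembled). No statement of any remaining item changed; thesis, mechanism, dictionary,
kill
criteria unchanged — the route got strictly shorter (one open-problem PDE crux fewer: an imploding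
classical
solution is now outside the Statement's scope instead of this route's liability).
REV 16 (route-repair rground, ground-failed, 2026-08-16T23:4xZ): the rev-15 Assembly (stmt-17601 =
the six-antecedent
`closes` chain KickFairRelEquilibriumMeso → SpectralContractionR → PercolationClosesChaos →
CollisionRate →
LocalSecondLaw → ChaosClosesEuler → HydrodynamicLimit) took the route's one BLOCKING ground flag:
with the dock
ChaosClosesEuler — whose conclusion IS the Statement verbatim since the re-type — among its
antecedents it is a
tautology modulo δ-unfolding, and the gate's battery closed it by `intros; aesop` (ground.trivial;
READY: no, ground
False, everything else green: glue OK, staffable, cruxes vetted 5/5). RESTATED 1:1 (same decl name,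
kind assembly,
rank 1) as the frame statement #1 `X → Statement` with X the chain MINUS the dock —
KickFairRelEquilibriumMeso →
SpectralContractionR → PercolationClosesChaos → CollisionRate → LocalSecondLaw →
_root_.HydrodynamicLimit — the
sibling pattern of JParityClosure (stmt-17595, uncurried twin of its dock ParityBandClosure) and
OneFlightGossipEngine
(stmt-17616, thesis line minus ClampedTransferDock), both ground-clean. It is implied by
ChaosClosesEuler by one line
(`fun hK hS hP hR hL => hC (hP hK hS) hR hL`, theorem `assemblyR_of_dock` in the planner's
Sketch.lean, farm rc 0)
and closes the moment the dock does; the same ground battery run on it inside Sketch.lean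
(`#h21_ground` on a local
copy) raises NO flag (all 12 positive, 9 negative, witness and 7 vacuity tactics fail). `closes` is
untouched (it
never quoted Assembly): still `hC (hP hK hS) hR hL` over the six cruxes. No crux, support or target
statement
changed; thesis, mechanism, dictionary, kill criteria unchanged.

RANKED CRUXES. #0 ContactChaos (target; verbatim re-filing of the retired stmt-3987 so that every
consumer shares one decl) — AVERAGED MOLECULAR CHAOS AT CONTACT at fixed reduced density: for σ <
σ₀(profiles), local Gibbs data, every horizon τ, continuous localiser χ and bounded continuous mark
test Ψ(ω, v, v*), the cross-ratio defect K_N[χ·Ψ·A_r] − K_N[χ·B^Ψ_r] of the normalised empirical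
collision measure K_N = (ε/(N+1)) Σ_{collisions ≤ τ, ordered contact pairs} against the r-mollified
empirical pair fields A_r = ∫∫Θ_1 μ⊗μ, B^Ψ_r = ∫∫Θ_Ψ μ⊗μ (Θ_Ψ(v,w) = ∫Ψ(ω,v,w)((w−v)·ω)₊dω) → 0 in
probability, N → ∞ then r → 0: in the limit κ̄_{t,x} = λ(t,x)((w−v)·ω)₊dω μ̄⊗μ̄ with the rate λ free
— the OUTPUT node of the engine. (why it might fail: dilution only bounds correlations created out
of equilibrium; exactness at fixed σ rests on KickFairRelEquilibriumMeso and on equilibrium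
identification; one smooth pre-shock profile with a non-factorising limit kernel at arbitrarily
small σ kills it and every Enskog-closure route.) [PolyanskiyWu2017, EvansEtAl2000, Soto2016,
Lanford1975, PulvirentiSimonella2016, Bogolyubov1975, arXiv:1504.03215]
#2 KickFairRelEquilibriumMeso (crux; rev-12 restatement of KickFairRelEquilibrium stmt-14914, held
under
KickFairRelEquilibrium_false_of_SubcellClusteringBiasPersists; itself the rev-4 restatement of
KickIsotropyInfo stmt-13478, held under KickIsotropyInfo_false_of_ShieldingBiasPersists) — KICKS ARE
AS FAIR AS IN EQUILIBRIUM, GIVEN THE MESOSCOPIC COARSE PAST. There is a cell sequence rs : ℕ → ℝ,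
rs N > 0, rs N → 0, (N+1)·(rs N)³ → ∞ (particles per cell diverge; ⟺ ε = σ(N+1)^{-1/3} ≪ rs N at
every fixed σ), such that for continuous positive profiles ∃σ₀: for σ < σ₀, every flow family Φ,
τ > 0, bounded continuous kick test g(ω, v, w), δ > 0 and N ≥ N₀, UNIFORMLY over measurable weights
|h_{i,n}| ≤ 1 of the past p_{i,n} of the n-th collision of sphere i (rs N-cells and exact
velocities of ALL spheres at the two flight starts, partner label, the three times; cut to the good
set) the COMPENSATED sum (ε/(N+1)) Σ_i Σ_{n: t_{i,n} ≤ τ} h_{i,n}(p_{i,n})·(g(ω_{i,n}, v⁻, v*⁻) −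
κ_{i,n}) has L¹(local Gibbs law) norm ≤ δ, κ_{i,n} = E_G[g | σ(p_{i,n})] the Mathlib condExp under
the INVARIANT canonical law G given the comap σ-algebra of the past map (≤ Borel thanks to the
good-set cut). WHAT CHANGED (rev 12): `∀ r > 0 … coarseCell r` ↦ `∃ rs (window, lower edge only) …
coarseCell (rs N)`, nothing else. Content: (a) EQUILIBRIUM — exactly-centred kicks of distinct
collisions decorrelate summably under G; (b) NON-EQUILIBRIUM — given the same mesoscopic past, kicks
under the evolved local Gibbs law are predicted by the EQUILIBRIUM kernel (shields, rings, tube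
overlaps included) up to o(1) — now genuinely o(1): every LG/G discrepancy on file given the past is
O(φ·rs²|∇log ρ|² + ε|∇| + ℓ/rs + Kn) → 0. Exact centring is immune to shield/ring witnesses of every
order; the two-snapshot past is subcritical for velocity-history pinning (≈ N/2 resolved collisions
< 1.5N; mesoscopic cells change that count not at all) and, with ε/rs → 0, for geometric pinning.
Line on file: Cruxes/KickFairRelEquilibrium/Lines/Sketch.lean (lead prover-line-14914, card
affine-fibre-statics composed with euler-time-beats-entropy): Stage 1 TransferToLocalGibbs LANDED
(p96578, KL-free density domination LG ≤ Λ^{N+1}G_{θ₁}; flux-disc L1 p98668; condExp-density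
p99854) — to be re-instantiated verbatim on the rs-let-chain; Stage 2 = ONE stub stub_eqKickTail
(super-exponential L¹-tail of the centred kick sum under the invariant law at every temperature,
every rate K), false at every FIXED r modulo SubcellModeTailLowerBound (Disproof F3) and consistent
exactly in the window ε ≪ rs ≪ N^{-1/6} the ∃ lets the prover occupy; crux-ideate r1 cards
atomise-the-tilt, only-strangers-matter (both sunk AT FIXED r by the same c₂B_U structure, alive in
the window). [difficulty: open-problem] (why it might fail: the non-equilibrium half is
Boltzmann-hypothesis class — nothing in print moves an equilibrium kick kernel to f₀∘Φ₋ₜ given a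
non-nested past at fixed φ; the window rests on a heuristic census of what is invisible to a
mesoscopic past — an unlisted G-cheap, LG-typical structure biasing kicks at O(1) sinks every
admissible sequence; the equilibrium half needs N-uniform summable centred-kick correlations for
moving scatterers, in print for 2 bodies only.) [doi:10.1090/surv/127, ChernovDolgopyat2009,
ChapmanCowling1970, GST2013, Soto2016, Spohn1991, BlackwellDubins1962, PolyanskiyWu2017,
KipnisLandim1999]
#3 SpectralContractionR (crux; rev-3 repair of SpectralContraction stmt-13479 — `Measurable f →`
inserted after a non-measurable Bochner-junk witness; mean-zero stays load-bearing) — SUBCRITICAL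
χ²-CONTRACTION OF THE HARD-SPHERE JUMP OPERATOR ON MEASURABLE MEAN-ZERO L²(π): (Kf)(v) =
ν(v)⁻¹∫∫((v−w)·ω)₊M(w) f(v − ((v−w)·ω)ω) dS dw, the one-collision operator of a tagged sphere in a
Maxwellian bath (Markov, reversible for π ∝ νM); CLAIM ∃ c < 1/2: ∫(Kf)²dπ ≤ c∫f²dπ on measurable
mean-zero L²(π), i.e. λ₂² < 1/2 = the Kesten–Stigum threshold for binary branching. Evidence: K PSD,
sector quotients 3/7 (linear), 7/15 (energy), λ₂ = 0.468 ± 0.001, λ₂² ≈ 0.22; analytic line c = 1/4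
(swap-symmetrisation + Schoenberg negative type under the flux pair law, one Cauchy–Schwarz) RUNNING
as a 6-stub Lean skeleton (lead prover-line-13913, composition SpectralContractionR_of
kernel-checked): stub_negType, stub_fluxPairNonpos, stub_normSqLeQuarter, stub_gainOpRep,
stub_partnerLaw LANDED, stub_coreBound proved locally and in flight (07:16Z); cdisprove NO KILL. In
tree the same operator is `TaggedSphereDiffusion.linearBoltzmannOp`/`gainOp` at β = 1 with the
qualitative gap `exists_spectralGap` (BodineauGallagherSaintRaymondInvent2016 L6.1). [difficulty: M]
(why it might fail: only a flux-normalisation slip in the core bound |Q(f,f)| ≤ ½(N+W) could still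
push λ₂² above 1/4; λ₂ = 0.468 numerics uncertified.) [doi:10.3934/krm.2008.1.521,
doi:10.1016/j.jfa.2015.05.002, doi:10.1080/23324309.2015.1086804, PolyanskiyWu2017, EvansEtAl2000,
CarlenCarvalhoGabetta2000, BodineauGallagherSaintRaymondInvent2016, Schoenberg1938]
#4 PercolationClosesChaos (crux; rev 12: re-filed over KickFairRelEquilibriumMeso — the engine must
run on
EVERY admissible cell sequence rs (it uses only rs → 0 and ε/rs → 0); rev 4: over
KickFairRelEquilibrium; rev 3: over SpectralContractionR) — THE PERCOLATION ENGINE (the card's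
transplanted theorem): KickFairRelEquilibriumMeso → SpectralContractionR → ContactChaos. Intended
proof (layer 2), SHIELD-AWARE: (i) network reduction — by KickFairRelEquilibriumMeso the impact
vectors are, given depth-1 MESOSCOPIC coarse pasts (cells rs N), distributed as under the INVARIANT
law (kernel κ^G, one-generation memory on
an O(φ) stratum), so along the realised collision DAG (`IsDagEdge`, `dagPaths`) incoming velocities
form an approximately-Markov network with EQUILIBRIUM node channels and bounded-depth LINEAGE
conditioning (never exact velocity histories of all spheres: pinning); prompt (shielded) collisions
merge with their parent into cluster nodes (size geometric, ratio ≍ φ); (ii) per-edge χ²-contraction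
≤ λ₂² + O(φ) in a local Maxwellian bath (SpectralContractionR; Galilean covariance; reversible
perturbation); (iii) PATH-PAIR CENSUS: E Σ_M (2λ₂² + O(φ))^M·`pathPairCount` over common-ancestor
path pairs ending at the two partners is finite uniformly in N at fixed σ (2^M/N global term + σ⁶2^M
M^{-3/2} local term, d = 3 transience); (iv) Polyanskiy–Wu percolation bound ⇒ pair χ²-information
at contact given the skeleton ≤ C Σ_M (2λ₂²)^M × census tail ⇒ FINITE MEMORY in collision
generations; (v) EQUILIBRIUM IDENTIFICATION: the finite-memory functional equals its value under the
invariant Gibbs law with the local parameters — for the one-collision marginal the flux-weighted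
product law (Palm isotropy: shields average out unconditionally; Soto2016 Ex. 4.3) — up to o_N(1) +
O(m·Kn): ContactChaos. Conserved means ride the critical sector 2λ₁ = 1 and are NOT forgotten — that
is hydrodynamics. Crux-ideate r1: virtual-pass-thinning. [deps: KickFairRelEquilibriumMeso,
SpectralContractionR, ContactChaos] [difficulty: open-problem] (why it might fail: sign-blind
dilution bounds an IDEALISED network: no SDPI/percolation theorem in print for approximately-Markov
DAGs with O(φ) node memory and an endogenous skeleton; skeleton-selection biases must cancel exactly
against local equilibrium (an O(σ³) residue is Euler-visible), and the census must hold under the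
evolved law.) [PolyanskiyWu2017, PolyanskiyWu2024, EvansEtAl2000, doi:10.1109/tit.2017.2782359,
arXiv:1508.06025, Soto2016, Cohen1967, DorfmanCohen1972, Rezakhanlou2003, MischlerMouhot2012]
#5 CollisionRate (crux since rev 8 — ledger rank 9: the re-badge kept the support slot, the # here
is the hardness order; support before) — RATE / CONTACT-VALUE IDENTIFICATION (verbatim re-filing of
stmt-AtomisticToContinuum-3988; the positional half of the Enskog closure, not addressed by
velocity-space percolation): ∃ universal η₀ > 0, for σ < σ₀(profiles), local Gibbs data, every τ, χ
and continuous cutoff g vanishing on [η₀, ∞): K_N[χ·g(σ³ρ^N_r)] − σ³∫_0^τ∫χ g Y(σ³ρ^N_r) B¹_r dx ds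
→ 0 in probability (N → ∞ then r → 0), B¹_r = ∫∫π|v−w| (mollified μ⊗μ), Y =
(3/2π)·hsExcessFreeEnergy′ the contact value. Three independent prover audits (pitem 13481 s0/s1/s2,
2026-08-16): open-problem, faithfully stated, constants re-derived. (why it might fail: needs the
pair correlation AT CONTACT of the evolved law to take the local-equilibrium value Y(σ³ρ) along the
flow — the positional Boltzmann–Enskog hypothesis at fixed σ; dynamic ring/shielding corrections of
relative order φ out of equilibrium would shift the rate at Euler-visible order.) [difficulty:
open-problem] [VanbeijerenErnst1973, Resibois1978, Lachowicz1998, Soto2016, Spohn1991]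
#6 LocalSecondLaw (crux since rev 8, ledger rank 9; shared stmt-13081, crux r5 of JParityClosure
with two checked lines) — LOCAL ENTROPY INEQUALITY IN PROBABILITY for the r-mollified empirical
fields with the hard-sphere entropy H(ρ,θ) = −ρ(3/2 log θ − log ρ − hsExcessFreeEnergy(ρσ³)): for
smooth φ ≥ 0 supported in [0,τ) × 𝕋³, P(∫∫H(∂_sφ + (m/ρ)·∇φ) + ∫H(0)φ(0) < −η) → 0 (N → ∞ then r →
0) under the conjunct's hypotheses — BF18's admissibility. (why it might fail: at Euler scaling the
leading entropy production vanishes by free balance and the local sign is that of the O(Kn)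
deviation; no in-probability local second law is known for deterministic spheres.) [difficulty:
open-problem] [Resibois1978, OllaVaradhanYau1993, Spohn1991, BrezinaFeireisl2018,
FeireislNovotny2012]
#7 ChaosClosesEuler (crux, NEW at rev 8; replaces the dropped support KineticClosure stmt-13482;
ledger rank 10 = last: by hardness it sits below every open-problem crux, size L, and it must render
after the cruxes it quotes) — CHAOS CLOSES EULER IN THE PACKING BAND: ContactChaos → CollisionRate →
LocalSecondLaw → [packing-guarded conjunct], the conclusion being VERBATIM the shared
packing-guarded
conjunct stmt-9133 (∃η₀ > 0: for classical hs-Euler solutions with ρσ³ < η₀ on [0,T) the empirical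
fields
converge in probability at every t < T; crux of ImplosionDichotomy, target of EulerCharacteristics)
= since
the re-type of 2026-08-16 the sub-problem decl `HydrodynamicLimit` ITSELF, so `closes` is the term
`hC (hP hK hS) hR hL` (rev 15; the guard removal DiluteSelfConsistency of revs 8–14 is gone) and the
proved
HsEosLowDensity (stmt-0768) is used, not assumed. Intended proof (BF18 dissipative format, MOMENTUM
flux only, energy by exact
conservation): (1) tightness of (μ^N, K_N) on the good set and Bogolyubov's EXACT weak equation for
the empirical measure of one trajectory (transport + ε⁻¹K_N[Δφ],
`Literature.Analysis.FluidPDE.CollisionWeakForm`); (2) after division by the collision frequency ≍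
N^{1/3} every limit collision measure annihilates collision-invariant defects; product form
(ContactChaos) + positive rate + Boltzmann's rigidity (measure version, arXiv:1504.03215) make
μ̄_{t,x} the local Maxwellian; (3) kinetic stress closes up to a defect dominated by the energy
defect (BF18 compatibility); the collisional transfer is read off K_N with the mark ((v−v*)·ω)ω⊗ω
truncated at |v−v*| ≤ L — ContactChaos for the truncated mark, CollisionMomentBound (child #7a) for
the remainder — and CollisionRate inside the band gives p = hsPressure (proved HsEosLowDensity); (4)
LocalSecondLaw = admissibility; (5) Březina–Feireisl relative energy against the classical solution
on [0,T) pins the limit; limit in law = in probability; (6) NO OVERCOMPRESSION (rate cutoff inactive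
on the EMPIRICAL density) is bootstrapped, not assumed: convergence on [0,s] + the landed
Lipschitz-clock / density-modulus lemmas of JParityClosure's DensityCap line (p76245, p76778,
DensityCap_of p83594 : HydroLimitInBand → DensityCap) give the cap on [0, s+δ]; the support
DensityCap (13082) is the fallback input. TWO-LAYER (recorded, not filed — planner-side --split is
final-cycle-only): children CollisionMomentBound (#7a, filed as SUPPORT at rev 10) and KineticDock
(#7b := ContactChaos → CollisionRate → LocalSecondLaw → CollisionMomentBound → HydroLimitInBand,
this node with the tail input as an explicit antecedent; the crux line's first stub), glue
CollisionMomentBound → KineticDock → ChaosClosesEuler (pure logic, Sketch.lean); provers take the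
tail input from #7a — it is NEVER claimed from bounded-mark chaos. Closable as filed: every input of
#7b is an antecedent, a proved item, or the documented bootstrap with a filed fallback. (why it
might fail: Maxwellian rigidity for measure-valued limits with vacuum/cold regions; BF18 for the hs
EOS fed with r-mollified IN-PROBABILITY admissibility instead of its renormalised inequality is
unprinted; the bootstrap needs the cap slightly beyond the converged interval.) [deps: ContactChaos,
CollisionRate, LocalSecondLaw, CollisionMomentBound, DensityCap, HsEosLowDensity] [difficulty: L]
[BrezinaFeireisl2018, BrezinaFeireisl2018Revisited, Bogolyubov1975, arXiv:1504.03215, Wiedemann2018,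
Resibois1978, Spohn1991, CIP1994]
#7a CollisionMomentBound (support since rev 10 — the foreseen layer-2 child / first stub of
ChaosClosesEuler, NOT routine; NEW) — SECOND VELOCITY MOMENTS OF THE COLLISION FUNCTIONAL ARE TIGHT
(the velocity-tail input of the kinetic closure, same K_N = (ε/(N+1)) Σ_{collision times ≤ τ}
Σ_{ordered contact pairs} as ContactChaos / CollisionRate): for continuous positive profiles ∃σ₀
∀σ<σ₀ ∀Φ ∀τ ∀δ ∃K_b ∃N₀ ∀N≥N₀: P_LG(K_N[1 + |v_i|² + |v_j|²] > K_b) ≤ δ (velocities at the collision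
instant; the mark is collision-invariant). Content: tightness of the normalised collision count
K_N[1] and uniform integrability of the momentum-transfer mark |(v−v*)·ω| ≤ |v−v*| against K_N
(remainder beyond |v−v*| > L is ≤ 2K_b/L) — exactly what lets bounded-mark ContactChaos close the
collisional momentum flux, the gap behind the four verdicts on 13482. Deliberately SECOND moments
(not the quartic CollisionTightness of LimitCollisionMeasure, stmt-13354: quartic functionals have
stretched-exponential, not speed-N, equilibrium tails, so the entropy transfer is void for them).
Expected proof: equilibrium mean by stationarity (collision-flux bound), a speed-N upper deviation
bound for the N^{4/3}-term collision functional under the invariant law, the entropy inequality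
H(LG|G) = O(N) (KipnisLandim1999 A1.8.2, in tree). (why it might fail: only Σ|v|² is conserved and a
collision functional weights fast pairs by their rate ∝ |v−v*| — third moments along the TRUE flow;
the transfer to local Gibbs data needs a speed-N deviation bound for an N^{4/3}-term collision sum,
unprinted at fixed σ — HighMomentumCutoffBarrierNarrow.) [difficulty: L] [OllaVaradhanYau1993,
Spohn1991, KipnisLandim1999, GST2013, CIP1994]
SUPPORTS. HsEosLowDensity (stmt-0768, PROVED: `HsEosLowDensity_holds`) — hard-sphere EOS at low
density, consumed inside the dock. DensityCap (stmt-13082; crux r6 of JParityClosure, line complete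
modulo HydroLimitInBand) — no overcompression before the shock; fallback input of the dock's step
(6). [Spohn1991, OllaVaradhanYau1993] DROPPED at rev 8: KineticClosure (stmt-13482; four prover
verdicts misstated — no tail input; superseded by #7 and its children) and the rev-5 Assembly
(stmt-14916, named KineticClosure); the new Assembly is the rev-8 `closes` chain. DROPPED at rev 15
(statement re-type hydro2): DiluteSelfConsistency (stmt-3091; crux #8 of revs 8–14, shared with
ImplosionLoophole r3 / OneFlightGossipEngine r7 and ~40 routes as support — THE CLASSICAL SOLUTION
STAYS
DILUTE: ∀ η > 0, profiles, ∃ σ₀, ∀ σ < σ₀, every classical hs-Euler solution on [0,T) tied to the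
local
Gibbs data by the t = 0 LLN keeps ρσ³ < η; why it might fail: smooth implosions of 3-D compressible
Euler,
MerleEtAl2022 / BuckmasterCaolaboraGomezserrano2025, if they survive the O(σ³) hs-EOS perturbation)
— it was
the guard removal for the UNGUARDED conjunct; the Statement now carries the guard itself, so nothing
in this
route consumes it; the rev-12 Assembly (stmt-15179, proved, seven antecedents) is superseded by the
six-crux
chain (rev 15, stmt-17601), itself RESTATED at rev 16 as the five-antecedent frame statement X →
Statement (the
dock removed from its antecedents: the six-antecedent chain was ground.trivial, see REV 16). HELD /
RE-FILED at
rev 12: KickFairRelEquilibrium (stmt-14914; negative lemma modulo SubcellClusteringBiasPersists,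
class misstated, kept by the gate as the record line of a settled negative edge) →
KickFairRelEquilibriumMeso; PercolationClosesChaos (stmt-14915) and the rev-8 Assembly (stmt-15140,
proved) re-filed over it under the same names; `closes` unchanged but for hK's type.

TWO-LAYER PLAN. Glued splits (k ≤ 3, depth 1), all foreseen (a planner-side --split is
final-cycle-only; ChaosClosesEuler's is fully specified, children.json in the planner folder).
PercolationClosesChaos ⇐ PathPairCensus (E Σ_M (2λ₂²)^M pathPairCount < ∞ uniformly in N under the
evolved law) → FiniteMemoryAtContact (the Polyanskiy–Wu bound on the realised DAG: contact pair
statistics given the depth-m coarse past are within C(2λ₂²)^m + o_N(1) of a functional of the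
conserved fields) → EquilibriumIdentification (that functional is the flux-weighted product law:
invariance of the Gibbs law + Soto Ex. 4.3) → PercolationClosesChaos. KickFairRelEquilibriumMeso ⇐
(the line `Sketch` as built by the lead, = the rev-4 family re-read in the window) EqKickTail
(EQUILIBRIUM, the one registered stub: under the homogeneous invariant law at every temperature θ₁
the δ-excess of the centred kick sum is super-exponentially small in L¹ at every rate K, uniformly
over admissible weights — u-saturation of past cylinders / growth lemma + counting, or
Pesin-pricing-class LD at the Kolmogorov–Sinai speed ≍ N^{4/3}; consistent only with mesoscopic
cells, Disproof F3) → TransferToLocalGibbs (LANDED p96578 for the rev-4 let-chain, KL-free: LG ≤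
Λ^{N+1}G_{θ₁} with θ₁ = 2 sup θ₀, split |S| ≤ δ/2 + (|S| − δ/2)₊, monotonicity of the lower
integral; re-instantiated verbatim on the rs-let-chain; the card's entropy-inequality variant
KipnisLandim1999 A1.8.2 is the fallback); kernel IDENTIFICATION EqKickKernel (flux law = uniform
impact parameter, LANDED p98668; impact line of a resolved kick; shields as support cuts) serves the
engine's step (v), not `KickFairRelEquilibriumMeso_of` (the crux is relative to κ whatever κ is).
The rev-1 children OneFlightStandardPairs → RingCompensation → KickDecorrelation are superseded
(RingCompensation is DEAD: the shielding bias does not cancel under Gibbs; negative lemma on 13478);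
the rev-4 reading at FIXED r is dead (negative lemma on 14914 + Disproof F3). ChaosClosesEuler ⇐
CollisionMomentBound (filed as support, rev 10)
→ KineticDock (stub) → ChaosClosesEuler (pure-logic glue, Sketch.lean); foreseen below that (as
`--supports` lemmas of KineticDock, never a third layer): LimitPairCompactness (tightness of (μ^N,
K_N) from CollisionMomentBound, Bogolyubov's exact weak equation, measurability on the good set) →
MaxwellianRigidityAndFluxes (local Maxwellian; hs-Euler momentum flux incl. the truncated
collisional transfer; pressure = hsPressure in the band) → MvWeakStrong (BF18 relative energy for
the hs EOS with the no-overcompression bootstrap; DensityCap 13082 as `--glue-by` fallback).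
CollisionMomentBound ⇐ EquilibriumCollisionMoments (E_G and a speed-N upper deviation bound for
K_N[1+|v|²+|w|²] under the invariant law: stationarity + collision-flux bound + an LD estimate for
the superextensive collision functional) → EntropyTransfer (KipnisLandim1999 A1.8.2, in tree; the
shape of card spacetime-superextensive-ld). SpectralContractionR ⇐ GainFormHalfBound (0 ≤ ⟨Kf,f⟩_π ≤
½‖f‖²_π on measurable mean-zero f: swap-symmetrisation
+ Schoenberg negative type under the flux pair law) → one Cauchy–Schwarz; fallback AngularSectorGap
(per spherical-harmonic sector, certified Galerkin) → RadialBound.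

KILL CRITERIA. (i) ¬SpectralContractionR (λ₂² ≥ 1/2 by an explicit MEASURABLE test function or a
certified Galerkin lower bound) kills the χ² engine: pivot ONCE to the KL currency at exact
criticality (entropy halving rescued by d = 3 transience), else `close --reason
refuted:SpectralContractionR`; the rev-3 restatement answered a TYPING kill and is the one
restatement this node gets. (ii) crux 2: rev 1 read '¬KickIsotropyInfo by a genuine mechanism —
close; by a typing artefact ⇒ restate'; the shielding kill IS a genuine mechanism, yet the node was
restated ONCE (rev 4, recorded deviation) because it kills the equilibrium identity, not the noisy
network the criterion guards. From rev 4: ¬KickFairRelEquilibrium by a genuine mechanism —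
centred-kick correlations NOT summable under the invariant law, or an O(1)-in-N gap between the
evolved and the equilibrium conditional kick laws given the same coarse past at arbitrarily small σ
— closes `refuted:KickFairRelEquilibrium`, no further restatement (a coarse-filtration successor
would be a NEW route); a typing artefact (good-set cut, condExp plumbing, enumeration) ⇒ restate
(misstated class). Rev 12 — second recorded deviation, and the LAST: SubcellClusteringBiasPersists
fires the rev-4 wording in letter (an O(1)-in-N gap AT FIXED r) but not in intent — the gap is ∝
r², vanishes in the limit ContactChaos itself takes (N → ∞ then r → 0), touches neither the noisy
network nor the equilibrium identity, and was classed misstated by disprover, memo and line lead;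
the node is re-typed to the mesoscopic window, not re-thought. FROM REV 12, FINAL:
¬KickFairRelEquilibriumMeso by any mechanism that survives the window — a kick-law defect not
vanishing along ANY admissible sequence (rs → 0, (N+1)rs³ → ∞): an rs-independent gap between the
evolved and the equilibrium conditional kick laws, centred-kick correlations not summable under the
invariant law, or a proof that every admissible sequence either degenerates κ or keeps a defect —
as a refutation OR as a negative lemma modulo an H that a planner cannot honestly call a typing
slip — closes `refuted:KickFairRelEquilibriumMeso` and the route with it (cruxes 3, 5–7 survive as
shared items; cards reopen); NO third restatement on scale, quantifier or filtration grounds: a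
coarse-velocity past (memo R3) or a lineage filtration is a NEW route. Pure typing slips (good-set
cut, condExp plumbing, the enumeration recycling of Disproof §5) ⇒ set-signature fixes only. (iii)
Event-driven MD (kit, a refuter's job on this compute-free hub)
showing pre-collisional pair correlation at contact GROWING with the number of generations past the
local horizon ≍ 2 log₂(1/φ), instead of a plateau
relaxing with Kn, refutes the dilution picture — close with the data. (iv) ¬ContactChaos (a
non-factorising limit kernel for a smooth pre-shock datum
at arbitrarily small σ) closes this route and every Enskog-closure route and is summit-level
negative evidence. (v) EXECUTED at rev 8: KineticClosure (13482) was found misstated by four provers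
through the velocity-tail gap and is replaced by ChaosClosesEuler with the tail input
CollisionMomentBound explicit (second moments of K_N, not HeatBathForgetting's CubicMomentUI
stmt-9454: the BF18 momentum-only format needs no cubic current); from rev 8, ¬CollisionMomentBound
(an N-uniformly non-tight K_N[|v|²] under local Gibbs data at arbitrarily small σ — energy cascade
to fast colliders) ⇒ restate the dock over a truncated-flux (defect-measure) closure ONCE, else
close `refuted:CollisionMomentBound`; ¬ChaosClosesEuler is impossible short of ¬HydroLimitInBand (it
is implied by its own conclusion), so that node can only die as misstated — a fifth such verdict
retires the chaos-level closure in favour of docking into LimitCollisionMeasure's LimitPairStability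
(13353) by bridge lemmas. ContactChaos proved by another
engine moots cruxes 2, 3, 4; FluxClosure (BoxDissipativeWeakStrong) or RelEntropyVanishing (0766)
proved elsewhere moots the route (supersede). (vi) From rev 15 DiluteSelfConsistency (3091) is not
an item of
this route: its refutation (an implosion of the classical hs-Euler solution surviving the O(σ³) EOS
perturbation) bears on the unguarded Literature conjecture, not on the guarded Statement or on this
line;
¬ChaosClosesEuler remains impossible short of ¬HydrodynamicLimit (its conclusion IS the Statement).

NOT DECOMPOSED YET. The percolation theorem itself on DAGs with continuous node states in χ²
currency (Polyanskiy–Wu / Evans–Schulman form; cite fact to be requested),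
the path-pair census and its a-priori collision-count bounds under the evolved law, robustness of λ₂
under near-Maxwellian baths, the velocity
truncation keeping posteriors in L²(π), the passage from law-level finite memory to one trajectory
(in probability), the cluster-node device for prompt
(shielded) collisions and the instantiate-on-one-flow/transfer-by-a.e.-uniqueness step inside
PercolationClosesChaos (now for an arbitrary admissible cell sequence); inside
KickFairRelEquilibriumMeso: the choice of the sequence (default (N+1)^{-1/4}) and the
re-instantiation of p96578 / p99854 on the rs-let-chain, the G-nullity of 'finitely many
collisions of i in (0,∞)' (Disproof §5: the cut n < cnt is σ(P)-measurable only modulo it),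
measurability of the good-set-cut past/record maps (joint measurability on the good set,
`HardSphereFlow.measurable_flow_prod`, + the enumeration
lemmas), the leading-order form of the equilibrium kernel (flux-uniform off visible caps; the Enskog
ST-admissible centring reproduces it in MD to
+0.0012 ± 0.0013 at φ = 0.05, kit j013210) and its summable memory, d = 3 only; inside
ChaosClosesEuler: tightness/measurability of the empirical pair on the good set, Maxwellian rigidity
for measures, the truncated collisional-transfer step, BF18 for the hs EOS, the no-overcompression
bootstrap; inside CollisionMomentBound: the equilibrium value and the speed-N deviation bound; NOT
filed as items (deliberately): bridge lemmas between this route's K_N-typed ContactChaos /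
CollisionRate (13477 / 13481) and LimitCollisionMeasure's `empiricalCollisionMeasure`-typed twins
(13350 / 13351) — pure bookkeeping (finsum over collision times = integral against the normalised
collision measure on the good set), to be proposed `--supports` by whichever prover first needs the
other typing. All are layer-2 children (Two-layer plan) or `--supports` lemmas.
Deliberately NOT filed: a fresh/ring split of the chaos defect as items (selection bias makes
neither sector vanish separately even in equilibrium, so 'ring-sector neutrality' lives inside
PercolationClosesChaos as equilibrium identification); 'kicks flux-fair given a lineage past' in ANY
absolute form (false at O(φ): shielding) and its one-instant variant (Disproof.lean §6: feeds no
engine).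

CHEAPEST FALSIFIER. Compute λ₂(K) (Galerkin per angular sector, or MC maximisation of ∫(Kf)²dπ/∫f²dπ
over low-order polynomials) — RUN since open (refuter seats on stmt-13479, kit j004803): K PSD, λ₂ =
0.468 ± 0.001, λ₂² ≈ 0.22 < 1/2, did not fire; linear f give ≤ 1/4, f = |v|² < 1/4; the KL ratio of
a fast input tends to 1/2, which is why the engine runs in χ² and not KL currency. Crux 2: the rev-1
check 'kick functional under the INVARIANT law with a short-flight weight' FIRED (third-body
shielding, T = +0.0178 ± 0.0004, kit j004861) and produced rev 4; against KickFairRelEquilibrium: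
equilibrium MD of the COMPENSATED shielding statistic (ST-Enskog residual +0.0012 ± 0.0013 at φ =
0.05, kit j013210) pushed to the next order in φ and to lag-1/lag-2 centred-kick correlations, then
the cheapest UNRUN one — the same statistic under NON-equilibrium local Gibbs data with adversarial
past-measurable h. Rev 12, against KickFairRelEquilibriumMeso (cheapest first): (a) pencil — re-run
the memo-§D census of structures invisible to a MESOSCOPIC past (cells (N+1)^{-1/4}, exact
velocities, two snapshots): anything G-cheap (probability ≥ e^{-o(1)N}) and long-lived (≥ τ) that
biases centred kicks at O(1) kills the stub, anything LG-typical with an rs-independent bias kills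
the decl; (b) the cartoon kit j017199 at two cell sizes — the LG/G defect must scale as r² with NO
constant remainder (a remainder is a window-independent bias: fatal); (c) the disprover's next
conditional lemma must name a defect surviving along (N+1)^{-1/4}. Rev-8 nodes: CollisionMomentBound
— equilibrium MD histogram of K_N[|v|²] across
N at fixed σ (must not drift) and the Gaussian computation of its Enskog mean; ChaosClosesEuler /
KineticDock — a prover reading BF18 §3 against LocalSecondLaw's format (a mismatch is a
misstatement, not a kill).

NUMBERS. (N+1)ε³ = σ³, ε = σ(N+1)^{-1/3}; mean free path ℓ = 1/(π(N+1)ε²), ℓ/ε = 1/(πσ³)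
N-independent; ≍ πσ²(N+1)^{1/3}⟨|v−w|⟩ collisions per particle per unit time, ≍ N^{4/3} in all, so
ε/(N+1) makes K_N and the kick sum O(σ³τ); under the network idealisation that sum has ≍ N^{4/3}
martingale-difference terms of size N^{-4/3}: variance ≍ N^{-4/3}. Per-collision kinematics: v′ =
(v+w)/2 + (|v−w|/2)n, E[v′ | v, w] = (v+w)/2 — linear transmission λ₁ = 1/2 exactly: conserved means
CRITICAL, 2λ₁ = 1. χ²: ⟨Kf,f⟩/‖f‖²_π = 3/7 (linear), 7/15 (energy); λ₂(K) = 0.468 ± 0.001, λ₂² ≈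
0.22 against 1/2. KL: η_KL ≥ 1/2 ⇒ exactly critical, not used. Local branching horizon m* ≈ 2
log₂(1/φ) ≈ 13 generations at φ = 0.05 against ≍ N^{1/3}t generations per Euler time. Ring fraction
per collision ≍ φ in d = 3 (Soto2016 p. 126); Enskog contact value Y(η) = 1 + (5π/12)η + O(η²), Z =
1 + (2π/3)ηY. Shielding: prompt-stratum weight ≈ ε/ℓ ≈ √2πσ³, empty cap = 1/4 of the sphere,
per-term bias T ≈ 0.5φ, +0.0178 at φ = 0.05; ST-Enskog-compensated residual +0.0012 ± 0.0013.
Sub-cell clustering (rev 12): factor 1 + r²|∇log ρ|²/6 (cube cell), E_Palm[B_U] = −0.00425(8) for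
cos² resp. −0.00174(3) for the Lean zonal test at φ = 0.05 (kit j017199), relative LG/G defect ≈
7·10⁻⁴(r|∇log a₀|)²; window ε = σ(N+1)^{-1/3} ≪ rs N ≪ (ℓv̄τ)^{1/2} ≍ N^{-1/6}, default rs N =
(N+1)^{-1/4}: ε/rs = σ(N+1)^{-1/12} → 0, mode lifetime rs²/(ℓv̄) ≍ σ²(N+1)^{-1/6} ≪ τ, particles
per cell (N+1)rs³ = (N+1)^{1/4} → ∞. Rev 8
census: 11 active top-level items — 1 target (ContactChaos), 7 cruxes (ledger ranks:
KickFairRelEquilibriumMeso 2 [rev 12; KickFairRelEquilibrium before], SpectralContractionR 3,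
PercolationClosesChaos 4, CollisionRate /
LocalSecondLaw / DiluteSelfConsistency 9 — re-badged in place —, ChaosClosesEuler 10), 3 supports
(HsEosLowDensity proved, DensityCap, CollisionMomentBound 1687 chars — the dock's tail input, rev
10), 1 assembly = 12 items; KineticDock (1237 chars) recorded as the dock's first stub;
ChaosClosesEuler 1213 chars; `closes` 7 hypotheses, 10 tactic lines, Sketch.lean rc 0; by hardness
KickFairRelEquilibriumMeso > PercolationClosesChaos > DiluteSelfConsistency ≈ LocalSecondLaw >
CollisionRate > CollisionMomentBound > KineticDock > SpectralContractionR (5/6 stubs landed). Rev 15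
census: 11 active
top-level items — 1 target (ContactChaos), 6 cruxes (ledger ranks: KickFairRelEquilibriumMeso 2,
SpectralContractionR 3 [PROVED 2026-08-16T13:14Z], PercolationClosesChaos 4, CollisionRate /
LocalSecondLaw 9,
ChaosClosesEuler 10), 3 supports (HsEosLowDensity proved, DensityCap, CollisionMomentBound), 1
assembly (rev
15: the six-crux chain, ground.trivial; rev 16: the five-antecedent frame statement X → Statement,
dock removed,
battery-clean); `closes` 6 hypotheses, one term; open by hardness KickFairRelEquilibriumMeso >
PercolationClosesChaos > LocalSecondLaw > CollisionRate > ChaosClosesEuler (CollisionMomentBound >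
KineticDock).

DEFINITION REQUESTS. None blocking: the collision-record / collision-DAG / coarse-past vocabulary
has LANDED (`Literature.Analysis.FluidPDE.HardSphereCollisionRecord` + `…Measurable`,
`…Enumeration`, `EmpiricalCollisionMeasure`) and KickFairRelEquilibriumMeso is typed over it
(`Torus.coarseCell (rs N)`, same record maps). Wanted as
a cite fact (layer-2 input of PercolationClosesChaos, a THEOREM in print): the
percolation-of-information bound for Bayesian networks, PolyanskiyWu2017 Thm. 5-type, and its χ²
analogue, topic Literature/Probability (PW2017 Thm 5/3 already vendored+discharged for finite
alphabets per grounder g30-0).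

Novelty: Searches (2026-08-15, this seat): `lit frontier AtomisticToContinuum --since 2022` (30 rows: DHM
Bourbaki exposé arXiv:2602.04407, "Heat equation
from a deterministic dynamics" doi:10.1007/s00222-026-01429-1, binary-collision moderate deviations
doi:10.1007/s10955-026-03570-w, Rayleigh-gas
cumulants arXiv:2605.19694 — nothing information-theoretic); `lit search --source crossref
"information percolation strong data processing
inequality interacting particle system propagation of chaos"` (11: PolyanskiyWu2024 SDPI chapter
doi:10.1017/9781108966351.046, thinning-Poisson SDPI
doi:10.1109/isit.2017.8007116, TV-W₁ long-time chaos for mean-field systems doi:10.3150/25-bej1913 —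
no collision trees); `lit search --source
crossref "uniform in time propagation of chaos inhomogeneous Boltzmann hard spheres stochastic
particle system Enskog"` (12: Rezakhanlou discrete
Boltzmann doi:10.1016/s0304-4149(96)00082-8, Wagner inhomogeneous stochastic system
doi:10.1080/00411459408203874, Cortez uniform chaos for Kac 1D
doi:10.1007/s10955-016-1674-x, Lampis–Petrina Boltzmann–Enskog limit doi:10.1007/bf02487342); `lit
search --source crossref "Hauray Mischler Kac
chaos entropic chaos Fisher information"` (doi:10.1016/j.jfa.2014.02.030, doi:10.4171/jems/465);
`lit galaxy search "percolation of information"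
--star all` (30 rows; only Eldan–Mikulincer–Pieters, community detection / information percolation
in a GEOMETRIC random graph, CUP 2022, is
mathematical — no kinetic theory); `lit galaxy search  [refs: 10.1007/s00222-026-01429-1, 10.1007/s10955-026-03570-w, 10.1017/9781108966351.046, 10.1109/isit.2017.8007116, 10.3150/25-bej1913, 10.1016/s0304-4149(96, 10.1080/00411459408203874, 10.1007/s10955-016-1674-x, 10.1007/bf02487342, 10.1016/j.jfa.2014.02.030, 10.4171/jems/465, 10.1007/978-1-4939-7005-6_7, 2602.04407, 2605.19694, 2506.14309, doi:10.1007/s00222-026-01429-1, doi:10.1007/s10955-026-03570-w,]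

Barriers (technique_class: information-percolation sdpi collision-dag chi2-contraction): - technique_class: information-percolation sdpi collision-dag chi2-contraction
- Literature.Barriers.AtomisticToContinuum.BoltzmannHypothesisBarrier: not evaded by the engine,
consumed by it — crux 2 IS a (sharply localised, flux-level, averaged) Boltzmann hypothesis and
carries rank 2 for that reason; since rev 5 in the equilibrium-RELATIVE form (kicks given the coarse
past are distributed as under the invariant law) and since rev 12 in the MESOSCOPIC relative form
KickFairRelEquilibriumMeso (the past read at a position scale rs N → 0 with (N+1)rs³ → ∞), after the
absolute form KickIsotropyInfo (13478) took the negative lemma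
KickIsotropyInfo_false_of_ShieldingBiasPersists (third-body shielding: an O(φ) conditional kick bias
present already under the INVARIANT law, kit j004861) and the fixed-cell relative form
KickFairRelEquilibrium (14914) took KickFairRelEquilibrium_false_of_SubcellClusteringBiasPersists
(sub-cell clustering of the collision point with unresolved third bodies × the O(φ) tube-overlap
bias: a relative LG/G defect ≈ 7·10⁻⁴(r|∇log ρ|)² at φ = 0.05, N-independent at fixed r, kit
j017199) — the barrier bit, twice, exactly where the caveats had located the risk, each time one
bookkeeping level above the kick; the relative form absorbs every equilibrium-present bias by
construction (κ = condExp under G given the same past) and the mesoscopic past sends every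
scale-dependent LG/G discrepancy on file to zero (O(φ rs²|∇|² + ε|∇| + ℓ/rs + Kn)); consistent with
the bar

History (route lifecycle, newest last):
- 2026-08-16T06:46:54Z · rev 5: restated KickIsotropyInfo (stmt-AtomisticToContinuum-13478), PercolationClosesChaos (stmt-AtomisticToContinuum-13914), Assembly (stmt-AtomisticToContinuum-13918 proved) — route-choice (rchoice, negative-lemma hold): crux 2 KickIsotropyInfo (stmt-AtomisticToContinuum-13478), held under KickIsotropyInfo_false_of_S (planner-rchoice-AtomisticToContinuum-Informati-974f4b2d-0)
- 2026-08-16T08:32:26Z · rev 9: restated Assembly (stmt-AtomisticToContinuum-14916) — rev 9 route-repair (rbadge), part 2 after the rev-8 re-badge: drop KineticClosure 13482 (4 prover verdicts misstated) + Assembly 14916; add crux ChaosClosesEule (planner-rbadge-AtomisticToContinuum-Informatio-358a5db0-0)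
- 2026-08-16T08:32:26Z · rev 9: dropped stmt-AtomisticToContinuum-13482 — rev 9 route-repair (rbadge), part 2 after the rev-8 re-badge: drop KineticClosure 13482 (4 prover verdicts misstated) + Assembly 14916; add crux ChaosClosesEule (planner-rbadge-AtomisticToContinuum-Informatio-358a5db0-0)
- 2026-08-16T12:31:18Z · rev 12: restated KickFairRelEquilibrium (stmt-AtomisticToContinuum-14914), PercolationClosesChaos (stmt-AtomisticToContinuum-14915), Assembly (stmt-AtomisticToContinuum-15140 proved) — route-choice (rchoice, negative-lemma hold): crux 2 KickFairRelEquilibrium (stmt-AtomisticToContinuum-14914) is held under KickFairRelE (planner-rchoice-AtomisticToContinuum-Informati-142c91b8-0)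
- 2026-08-16T23:23:17Z · rev 15: restated Assembly (stmt-AtomisticToContinuum-15179 proved) — rev 15 route-repair (statement re-type hydro2, p126922): `HydrodynamicLimit` is now the packing-guarded conjunct = ChaosClosesEuler's conclusion verbatim, so `c (planner-rrepair-AtomisticToContinuum-Informati-19755f69-0)
- 2026-08-16T23:23:17Z · rev 15: dropped stmt-AtomisticToContinuum-3091 — rev 15 route-repair (statement re-type hydro2, p126922): `HydrodynamicLimit` is now the packing-guarded conjunct = ChaosClosesEuler's conclusion verbatim, so `c (planner-rrepair-AtomisticToContinuum-Informati-19755f69-0)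
- 2026-08-16T23:42:18Z · rev 16: restated Assembly (stmt-AtomisticToContinuum-17601) — rev 16 route-repair (rground, ground-failed): Assembly stmt-17601 (= closes chain incl. the dock ChaosClosesEuler, whose conclusion is the Statement verbatim) w (planner-rground-AtomisticToContinuum-Informatio-358a5db0-0)
- 2026-08-24T07:09:28Z · DORMANT — reconciler: no traction for 6.6 d (last activity item-evidence-added at 2026-08-17T16:40:18Z); parked, not closed — `ledger route dormant route-AtomisticToConti (operator:999:4068620)

sub-problem: HydrodynamicLimit · status: dormant · opened planner-plancard-AtomisticToContinuum-Hydrody-af3268db-g2-0 2026-08-15T19:01:55Z · rev 16 · ledger route-AtomisticToContinuum-InformationPercolationEngine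
GENERATED by the gate from the ledger (D-0016/17). Provers cite these decls: `theorem foo : Summit.AtomisticToContinuum.HydrodynamicLimit.Theses.InformationPercolationEngine.<Decl> := …` in Summits/AtomisticToContinuum/HydrodynamicLimit/Theorems/<Name>.lean.
-/

namespace Summit.AtomisticToContinuum.HydrodynamicLimit.Theses.InformationPercolationEngine

open scoped BigOperators Topology Manifold Classical MeasureTheory ProbabilityTheory Matrix InnerProductSpace ComplexConjugate ContinuousMap
open Filter Set Function TopologicalSpace MeasureTheory

attribute [summit_statement] _root_.HydrodynamicLimit

/-- item stmt-AtomisticToContinuum-13477 · target · rank 0 · open · by planner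
why it might fail: Dilution bounds only out-of-equilibrium correlations; exactness at fixed σ rests on KickFairRelEquilibrium and on equilibrium identification (shields/rings inside the equilibrium kernel; an O(σ³) residue is Euler-visible); a pre-shock profile with a non-factorising limit kernel at small σ kills it.
sources: PolyanskiyWu2017, EvansEtAl2000, Soto2016, Lanford1975, PulvirentiSimonella2016, Bogolyubov1975
[target] AVERAGED MOLECULAR CHAOS AT CONTACT at fixed reduced density (verbatim re-filing of the
retired item stmt-AtomisticToContinuum-3987 of CollisionMeasureChaos / InformationPercolation, so
that every consumer shares one decl): for σ < σ₀(profiles), local Gibbs data, every horizon τ,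
continuous space-time localiser χ and bounded continuous mark test Ψ(ω, v, v*), the cross-ratio
defect K_N[χ·Ψ·A_r] − K_N[χ·B^Ψ_r] of the normalised empirical collision measure K_N = (ε/(N+1))
Σ_{collisions ≤ τ, ordered contact pairs} against the r-mollified empirical pair fields A_r = ∫∫Θ_1
μ⊗μ, B^Ψ_r = ∫∫Θ_Ψ μ⊗μ (Θ_Ψ(v,w) = ∫Ψ(ω,v,w)((w−v)·ω)₊dω) tends to 0 in probability, N → ∞ then r →
0: in the limit κ̄_{t,x}(dω dv dw) = λ(t,x)((w−v)·ω)₊dω μ̄_{t,x}(dv)μ̄_{t,x}(dw) with the rate λ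
free. The OUTPUT node of the percolation engine. -/
@[route_item "route-AtomisticToContinuum-InformationPercolationEngine"]
def ContactChaos : Prop :=
  ∀ (a₀ θ₀ : Literature.MathematicalPhysics.KineticTheory.T3 → ℝ) (u₀ : Literature.MathematicalPhysics.KineticTheory.T3 → Literature.MathematicalPhysics.KineticTheory.V3), Continuous a₀ → Continuous θ₀ → Continuous u₀ → (∀ x, 0 < a₀ x) → (∀ x, 0 < θ₀ x) → ∃ σ₀ : ℝ, 0 < σ₀ ∧ ∀ σ : ℝ, 0 < σ → σ < σ₀ → ∀ Φ : (N : ℕ) → Literature.Analysis.FluidPDE.HardSphereFlow (Literature.Analysis.FluidPDE.Torus.geometry (Fin 3)) (Literature.MathematicalPhysics.KineticTheory.hsDiameter σ N) (N + 1), ∀ τ : ℝ, 0 < τ → ∀ χ : ℝ × Literature.MathematicalPhysics.KineticTheory.T3 → ℝ, Continuous χ → ∀ Ψ : Literature.MathematicalPhysics.KineticTheory.V3 × Literature.MathematicalPhysics.KineticTheory.V3 × Literature.MathematicalPhysics.KineticTheory.V3 → ℝ, Continuous Ψ → (∃ C : ℝ, ∀ p, |Ψ p| ≤ C) → ∀ η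 δ : ℝ, 0 < η → 0 < δ → ∃ r₀ : ℝ, 0 < r₀ ∧ ∀ r : ℝ, 0 < r → r < r₀ → ∃ N₀ : ℕ, ∀ N : ℕ, N₀ ≤ N → let ε := Literature.MathematicalPhysics.KineticTheory.hsDiameter σ N; let G : Literature.Analysis.FluidPDE.Geometry (Fin 3) Literature.MathematicalPhysics.KineticTheory.T3 := Literature.Analysis.FluidPDE.Torus.geometry (Fin 3); let γ : Literature.Analysis.FluidPDE.Config (N + 1) (Fin 3) Literature.MathematicalPhysics.KineticTheory.T3 → ℝ → Literature.Analysis.FluidPDE.Config (N + 1) (Fin 3) Literature.MathematicalPhysics.KineticTheory.T3 := fun z s => (Φ N).flow s z; let bx : Literature.MathematicalPhysics.KineticTheory.T3 → Literature.MathematicalPhysics.KineticTheory.T3 → ℝ := fun x y => 3 / (Real.pi * r ^ 3) * max (1 - Literature.Analysis.FluidPDE.Torus.euclidDist x y / r) 0; let bt : ℝ → ℝ := fun a => r⁻¹ * max (1 - |a| / r) 0; let Θ := fun (Ξ : Literature.MathematicalPhysics.KineticTheory.V3 × Literature.MathematicalPhysics.KineticTheory.V3 × Literature.MathematicalPhysics.KineticTheory.V3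 → ℝ) (v w : Literature.MathematicalPhysics.KineticTheory.V3) => ∫ ω : Metric.sphere (0 : Literature.MathematicalPhysics.KineticTheory.V3) 1, Ξ ((ω : Literature.MathematicalPhysics.KineticTheory.V3), v, w) * Literature.MathematicalPhysics.KineticTheory.hardSphereKernel (w, v) ω ∂Literature.MathematicalPhysics.KineticTheory.sphereMeasure; let Pm : (Literature.MathematicalPhysics.KineticTheory.V3 → Literature.MathematicalPhysics.KineticTheory.V3 → ℝ) → Literature.Analysis.FluidPDE.Config (N + 1) (Fin 3) Literature.MathematicalPhysics.KineticTheory.T3 → ℝ → Literature.MathematicalPhysics.KineticTheory.T3 → ℝ := fun Th z s₀ x₀ => ∫ s in Set.Icc (0 : ℝ) τ, bt (s - s₀) * ∫ p, bx p.1.1 x₀ * bx p.2.1 x₀ * Th p.1.2 p.2.2 ∂((Literature.Analysis.FluidPDE.empiricalMeasure (γ z s)).prod (Literature.Analysis.FluidPDE.empiricalMeasure (γ z s))); let Kc : (Literature.Analysis.FluidPDE.Config (N + 1) (Fin 3) Literature.MathematicalPhysics.KineticTheory.T3 → ℝ → Fin (N + 1) → Fin (N + 1) → ℝ) → Literature.Analysis.FluidPDE.Config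 (N + 1) (Fin 3) Literature.MathematicalPhysics.KineticTheory.T3 → ℝ := fun F z => ε / (N + 1 : ℝ) * ∑ᶠ (s : ℝ) (_ : s ∈ Literature.Analysis.FluidPDE.collisionTimes G ε (γ z) ∩ Set.Icc 0 τ), ∑ i : Fin (N + 1), ∑ j : Fin (N + 1), (if i ≠ j ∧ ‖G.sepVec (γ z s i).1 (γ z s j).1‖ = ε then F z s i j else 0); let pv : Literature.Analysis.FluidPDE.Config (N + 1) (Fin 3) Literature.MathematicalPhysics.KineticTheory.T3 → ℝ → Fin (N + 1) → Fin (N + 1) → Literature.MathematicalPhysics.KineticTheory.V3 × Literature.MathematicalPhysics.KineticTheory.V3 := fun z s i j => Literature.Analysis.FluidPDE.reflectVel (G.sepVec (γ z s i).1 (γ z s j).1) ((γ z s i).2, (γ z s j).2); let D := fun z : Literature.Analysis.FluidPDE.Config (N + 1) (Fin 3) Literature.MathematicalPhysics.KineticTheory.T3 => Kc (fun z s i j => χ (s, (γ z s i).1) * Ψ (ε⁻¹ • G.sepVec (γ z s i).1 (γ z s j).1, (pv z s i j).1, (pv z s i j).2) * Pm (Θ (fun _ => 1)) z s (γ z s i).1)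 z - Kc (fun z s i _ => χ (s, (γ z s i).1) * Pm (Θ Ψ) z s (γ z s i).1) z; Literature.MathematicalPhysics.KineticTheory.localGibbsLaw σ a₀ u₀ θ₀ N (Φ N) {z | η < |D z|} ≤ ENNReal.ofReal δ

/-- item stmt-AtomisticToContinuum-15177 · crux · rank 2 · open · by planner
why it might fail: Non-equilibrium half is Boltzmann-hypothesis class (nothing in print moves an equilibrium kick kernel to the evolved law given a non-nested past at fixed φ); the window rests on a heuristic census of what a mesoscopic past hides — an unlisted G-cheap, LG-typical O(1) kick bias sinks every sequence.
sources: doi:10.1090/surv/127, ChernovDolgopyat2009, ChapmanCowling1970, GST2013, Soto2016, Spohn1991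
[crux] KICKS ARE AS FAIR AS IN EQUILIBRIUM, GIVEN THE MESOSCOPIC COARSE PAST (rev-12 restatement of
KickFairRelEquilibrium stmt-AtomisticToContinuum-14914, HELD under the negative lemma
KickFairRelEquilibriumNegative.KickFairRelEquilibrium_false_of_SubcellClusteringBiasPersists; itself
the rev-4 restatement of KickIsotropyInfo stmt-AtomisticToContinuum-13478, held under
KickIsotropyInfo_false_of_ShieldingBiasPersists). CLAIM: there is a cell sequence rs : ℕ → ℝ with rs
N > 0, rs N → 0 and (N+1)·(rs N)³ → ∞ (particles per cell diverge; at every fixed σ this is ε =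
σ(N+1)^{-1/3} ≪ rs N, so the past never pins an impact vector) such that for continuous positive
profiles ∃σ₀ ∀σ<σ₀ ∀ flow families Φ ∀τ ∀ bounded continuous g(ω,v,w) ∀δ ∃N₀ ∀N≥N₀, UNIFORMLY over
measurable |h_{i,n}| ≤ 1 of the past p_{i,n} = (rs N-cells and exact velocities of ALL spheres at
the two flight starts [`coarsePastOf (Torus.coarseCell (rs N))`], partner label, times (s_i, s_q,
t_{i,n})), cut to the good set: E_{LG}|(ε/(N+1)) Σ_i Σ_{n: t_{i,n} ≤ τ}
h_{i,n}(p_{i,n})·(g(ω_{i,n},v⁻,v*⁻) − κ_{i,n})| ≤ δ, κ_{i,n} := E_G[g(ω_{i,n},v⁻,v*⁻) | σ(p_{i,n})]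
Mathlib's condExp under the INVARIANT canonical law G = localGibbs -/
@[route_item "route-AtomisticToContinuum-InformationPercolationEngine", crux]
def KickFairRelEquilibriumMeso : Prop :=
  ∃ rs : ℕ → ℝ, (∀ N, 0 < rs N) ∧ Filter.Tendsto rs Filter.atTop (nhds 0) ∧ Filter.Tendsto (fun N : ℕ => ((N : ℝ) + 1) * rs N ^ 3) Filter.atTop Filter.atTop ∧ ∀ (a₀ θ₀ : Literature.MathematicalPhysics.KineticTheory.T3 → ℝ) (u₀ : Literature.MathematicalPhysics.KineticTheory.T3 → Literature.MathematicalPhysics.KineticTheory.V3), Continuous a₀ → Continuous θ₀ → Continuous u₀ → (∀ x, 0 < a₀ x) → (∀ x, 0 < θ₀ x) → ∃ σ₀ : ℝ, 0 < σ₀ ∧ ∀ σ : ℝ, 0 < σ → σ < σ₀ → ∀ Φ : (N : ℕ) → Literature.Analysis.FluidPDE.HardSphereFlow (Literature.Analysis.FluidPDE.Torus.geometry (Fin 3)) (Literature.MathematicalPhysics.KineticTheory.hsDiameter σ N) (N + 1), ∀ τ : ℝ, 0 < τ → ∀ g : Literature.MathematicalPhysics.KineticTheory.V3 × Literature.MathematicalPhysics.KineticTheory.V3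 × Literature.MathematicalPhysics.KineticTheory.V3 → ℝ, Continuous g → (∃ C : ℝ, ∀ p, |g p| ≤ C) → ∀ δ : ℝ, 0 < δ → ∃ N₀ : ℕ, ∀ N : ℕ, N₀ ≤ N → ∀ h : Fin (N + 1) → ℕ → (((Fin (N + 1) → (Fin 3 → ℤ) × Literature.MathematicalPhysics.KineticTheory.V3) × (Fin (N + 1) → (Fin 3 → ℤ) × Literature.MathematicalPhysics.KineticTheory.V3)) × Fin (N + 1)) × (ℝ × ℝ × ℝ) → ℝ, (∀ i n, Measurable (h i n)) → (∀ i n p, |h i n p| ≤ 1) → let ε := Literature.MathematicalPhysics.KineticTheory.hsDiameter σ N; let G : Literature.Analysis.FluidPDE.Geometry (Fin 3) Literature.MathematicalPhysics.KineticTheory.T3 := Literature.Analysis.FluidPDE.Torus.geometry (Fin 3); let q : Literature.MathematicalPhysics.KineticTheory.T3 → (Fin 3 → ℤ) := Literature.Analysis.FluidPDE.Torus.coarseCell (rs N); let γ : Literature.Analysis.FluidPDE.Config (N + 1) (Fin 3) Literature.MathematicalPhysics.KineticTheory.T3 → ℝ → Literature.Analysis.FluidPDE.Config (N + 1) (Fin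 3) Literature.MathematicalPhysics.KineticTheory.T3 := fun z s => (Φ N).flow s z; let cnt : Literature.Analysis.FluidPDE.Config (N + 1) (Fin 3) Literature.MathematicalPhysics.KineticTheory.T3 → Fin (N + 1) → ℕ := fun z i => Set.ncard (Literature.Analysis.FluidPDE.collisionTimesOf G ε (γ z) i ∩ Set.Ioc 0 τ); let P : Literature.Analysis.FluidPDE.Config (N + 1) (Fin 3) Literature.MathematicalPhysics.KineticTheory.T3 → Fin (N + 1) → ℕ → (((Fin (N + 1) → (Fin 3 → ℤ) × Literature.MathematicalPhysics.KineticTheory.V3) × (Fin (N + 1) → (Fin 3 → ℤ) × Literature.MathematicalPhysics.KineticTheory.V3)) × Fin (N + 1)) × (ℝ × ℝ × ℝ) := fun z i n => if z ∈ (Φ N).good then (((Φ N).coarsePastOf q i n z, (Φ N).nthPartnerOf i n z), (Literature.Analysis.FluidPDE.flightStart G ε (γ z) 0 i ((Φ N).nthCollisionTimeOf i n z), Literature.Analysis.FluidPDE.flightStart G ε (γ z) 0 ((Φ N).nthPartnerOf i n z) ((Φ N).nthCollisionTimeOf i n z), (Φ N).nthCollisionTimeOf i n z)) else (((fun _ =>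 (0, 0), fun _ => (0, 0)), 0), (0, 0, 0)); let X : Fin (N + 1) → ℕ → Literature.Analysis.FluidPDE.Config (N + 1) (Fin 3) Literature.MathematicalPhysics.KineticTheory.T3 → Literature.MathematicalPhysics.KineticTheory.V3 × Literature.MathematicalPhysics.KineticTheory.V3 × Literature.MathematicalPhysics.KineticTheory.V3 := fun i n z => if z ∈ (Φ N).good then (((Φ N).nthRecordOf i n z).impactVec, ((Φ N).nthRecordOf i n z).preVel) else 0; let κ : Fin (N + 1) → ℕ → Literature.Analysis.FluidPDE.Config (N + 1) (Fin 3) Literature.MathematicalPhysics.KineticTheory.T3 → ℝ := fun i n => MeasureTheory.condExp (MeasurableSpace.comap (fun z => P z i n) inferInstance) (Literature.MathematicalPhysics.KineticTheory.localGibbsLaw σ (fun _ => 1) (fun _ => 0) (fun _ => 1) N (Φ N)) (fun z => g (X i n z)); let S : Literature.Analysis.FluidPDE.Config (N + 1) (Fin 3) Literature.MathematicalPhysics.KineticTheory.T3 → ℝ := fun z => ε / (N + 1 : ℝ) * ∑ i : Fin (N + 1), ∑ n ∈ Finset.range (cnt z i), h i n (P z i n) * (g (X i n z) - κ i n z); ∫⁻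 z, ENNReal.ofReal |S z| ∂(Literature.MathematicalPhysics.KineticTheory.localGibbsLaw σ a₀ u₀ θ₀ N (Φ N)) ≤ ENNReal.ofReal δ

/-- item stmt-AtomisticToContinuum-13913 · crux · rank 3 · closed · proved by Summit.AtomisticToContinuum.HydrodynamicLimit.Cruxes.SpectralContractionR.SwapSymmetrisation.SpectralContractionR_proof (prover) · by planner
why it might fail: c = 1/4 line 4/6 kernel-checked (negative type, flux-pair sign, polarisation, gain-op dictionary); open: hat-box isotropy of the partner law and core bound |Q(f,f)| ≤ ½(N+W) by the collision involution — a flux-normalisation slip there is the last way to λ₂² > 1/4 (λ₂ = 0.468 numerics uncertified).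
sources: doi:10.3934/krm.2008.1.521, doi:10.1016/j.jfa.2015.05.002, doi:10.1080/23324309.2015.1086804, PolyanskiyWu2017, EvansEtAl2000, CarlenCarvalhoGabetta2000
[crux] repaired SpectralContraction (stmt-AtomisticToContinuum-13479, refuted-misstated by
Summit.AtomisticToContinuum.HydrodynamicLimit.Theorems.InformationPercolationEngineSpectralContraction_refuted
@ 1aef2ab59ca9: `∀ f : V3 → ℝ` carried no measurability, so f = ∓1 on/off a Sierpiński sphere set —
not null-measurable, finite on every round sphere — met the integrability hypothesis (f² = 1) and
the mean-zero hypothesis by Bochner junk while K f ≡ 1, giving Z ≤ cZ). WHAT CHANGED: `Measurable f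
→` inserted after `∀ f`, nothing else (= the refuter's repair C′, its
`SpectralContractionMeasurable`; with it f·νM is integrable, the mean is a genuine mean, inner
Bochner junk in K f lives on v-null sets and outer junk only favours the inequality; mean-zero stays
load-bearing — refuter's spectralContractionMeasurable_false_without_meanZero). CLAIM: SUBCRITICAL
χ²-CONTRACTION OF THE HARD-SPHERE JUMP OPERATOR on measurable mean-zero L²(π): M the standard
Maxwellian on ℝ³, ν(v) = ∫∫((v−w)·ω)₊M(w)dS(ω)dw, (Kf)(v) = ν(v)⁻¹∫∫((v−w)·ω)₊M(w) f(v − ((v−w)·ω)ω)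
dS dw the one-collision operator of a tagged sphere in a Maxwellian bath of equal spheres (Markov,
reversible for π ∝ νM; in tree: TaggedSph -/
@[route_item "route-AtomisticToContinuum-InformationPercolationEngine", crux]
def SpectralContractionR : Prop :=
  ∃ c : ℝ, c < 1 / 2 ∧ let M : Literature.MathematicalPhysics.KineticTheory.V3 → ℝ := Literature.Analysis.FluidPDE.globalMaxwellian; let S : MeasureTheory.Measure (Metric.sphere (0 : Literature.MathematicalPhysics.KineticTheory.V3) 1) := Literature.MathematicalPhysics.KineticTheory.sphereMeasure; let ν : Literature.MathematicalPhysics.KineticTheory.V3 → ℝ := fun v => ∫ w, ∫ ω, Literature.MathematicalPhysics.KineticTheory.hardSphereKernel (v, w) ω * M w ∂S; let K : (Literature.MathematicalPhysics.KineticTheory.V3 → ℝ) → Literature.MathematicalPhysics.KineticTheory.V3 → ℝ := fun f v => (ν v)⁻¹ * ∫ w, ∫ ω, Literature.MathematicalPhysics.KineticTheory.hardSphereKernel (v, w) ω * M w * f (Literature.MathematicalPhysics.KineticTheory.collide ω (v, w)).1 ∂S; ∀ f : Literature.MathematicalPhysics.KineticTheory.V3 → ℝ, Measurable f → MeasureTheory.Integrable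 (fun v => f v ^ 2 * (ν v * M v)) → ∫ v, f v * (ν v * M v) = 0 → ∫ v, K f v ^ 2 * (ν v * M v) ≤ c * ∫ v, f v ^ 2 * (ν v * M v)

-- earlier PercolationClosesChaos (stmt-AtomisticToContinuum-13480, replaced 2026-08-15T23:02:00Z -> stmt-AtomisticToContinuum-13914): retired by None — KickIsotropyInfo → SpectralContraction → ContactChaos
-- earlier PercolationClosesChaos (stmt-AtomisticToContinuum-13914, replaced 2026-08-16T06:46:54Z -> stmt-AtomisticToContinuum-14915): retired by None — KickIsotropyInfo → SpectralContractionR → ContactChaos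
-- earlier PercolationClosesChaos (stmt-AtomisticToContinuum-14915, replaced 2026-08-16T12:31:18Z -> stmt-AtomisticToContinuum-15178): retired by None — KickFairRelEquilibrium → SpectralContractionR → ContactChaos
/-- item stmt-AtomisticToContinuum-15178 · crux · rank 4 · open · by planner
why it might fail: Dilution bounds an idealised network: no SDPI/percolation theorem in print for approximately-Markov DAGs with O(φ) node memory and endogenous skeleton, on ANY admissible cell sequence; skeleton-selection biases must cancel EXACTLY against local equilibrium (an O(σ³) residue is Euler-visible).
sources: PolyanskiyWu2017, PolyanskiyWu2024, EvansEtAl2000, doi:10.1109/tit.2017.2782359, arXiv:1508.06025, Soto2016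
[crux] THE PERCOLATION ENGINE (crux; rev 12: re-filed over KickFairRelEquilibriumMeso — the engine
must run on EVERY admissible cell sequence rs (it uses only rs → 0 and ε/rs → 0); rev 4: over
KickFairRelEquilibrium; rev 3: over SpectralContractionR) — THE PERCOLATION ENGINE (the card's
transplanted theorem): KickFairRelEquilibriumMeso → SpectralContractionR → ContactChaos. Intended
proof (layer 2), SHIELD-AWARE: (i) network reduction — by KickFairRelEquilibriumMeso the impact
vectors are, given depth-1 MESOSCOPIC coarse pasts (cells rs N), distributed as under the INVARIANT
law (kernel κ^G, one-generation memory on an O(φ) stratum), so along the realised collision DAG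
(`IsDagEdge`, `dagPaths`) incoming velocities form an approximately-Markov network with EQUILIBRIUM
node channels and bounded-depth LINEAGE conditioning (never exact velocity histories of all spheres:
pinning); prompt (shielded) collisions merge with their parent into cluster nodes (size geometric,
ratio ≍ φ); (ii) per-edge χ²-contraction ≤ λ₂² + O(φ) in a local Maxwellian bath
(SpectralContractionR; Galilean covariance; reversible perturbation); (iii) PATH-PAIR CENSUS: E Σ_M
(2λ₂² + O(φ))^M·`pathPairCount` over comm -/
@[route_item "route-AtomisticToContinuum-InformationPercolationEngine", crux]
def PercolationClosesChaos : Prop :=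
  KickFairRelEquilibriumMeso → SpectralContractionR → ContactChaos

/-- item stmt-AtomisticToContinuum-13081 · crux · rank 9 · open · by planner
why it might fail: At Euler scaling the leading entropy production vanishes by free balance and the local sign is that of the O(Kn) deviation (Navier–Stokes-order dissipation incl. the configurational entropy current); no in-probability local second law is known for deterministic spheres.
sources: Resibois1978, OllaVaradhanYau1993, Spohn1991, BrezinaFeireisl2018, FeireislNovotny2012
[crux] (re-ask of stmt-3989 verbatim) local entropy inequality in probability for the r-mollified
empirical fields (ρ, m, e)^N_r with θ = (2/3)(e/ρ − |m|²/2ρ²) and H(ρ,θ) = −ρ(3/2 log θ − log ρ −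
hsExcessFreeEnergy(ρσ³)): under the conjunct's hypotheses (classical hs-Euler solution on [0,T),
local Gibbs data with the t = 0 LLN), for τ < T... for every smooth φ ≥ 0 supported in [0,τ) × 𝕋³,
P(∫∫ H(∂_sφ + (m/ρ)·∇φ) dx ds + ∫H(ρ(0),θ(0))φ(0) dx < −η) → 0 as N → ∞ then r → 0 — the
admissibility the relative-energy method consumes for the complete Euler system; the kinetic H-split
controls only the one-particle entropy, the configurational −f_ex part is this item's business.
[difficulty: open-problem] -/
@[route_item "route-AtomisticToContinuum-InformationPercolationEngine", crux]
def LocalSecondLaw : Prop :=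
  ∀ (a₀ θ₀ : Literature.MathematicalPhysics.KineticTheory.T3 → ℝ) (u₀ : Literature.MathematicalPhysics.KineticTheory.T3 → Literature.MathematicalPhysics.KineticTheory.V3), Continuous a₀ → Continuous θ₀ → Continuous u₀ → (∀ x, 0 < a₀ x) → (∀ x, 0 < θ₀ x) → ∃ σ₀ : ℝ, 0 < σ₀ ∧ ∀ σ : ℝ, 0 < σ → σ < σ₀ → ∀ (T : ℝ) (ρ θ : ℝ → Literature.MathematicalPhysics.KineticTheory.T3 → ℝ) (u : ℝ → Literature.MathematicalPhysics.KineticTheory.T3 → Literature.MathematicalPhysics.KineticTheory.V3), Literature.MathematicalPhysics.KineticTheory.IsHardSphereEulerSolution σ T ρ u θ → ∀ Φ : (N : ℕ) → Literature.Analysis.FluidPDE.HardSphereFlow (Literature.Analysis.FluidPDE.Torus.geometry (Fin 3)) (Literature.MathematicalPhysics.KineticTheory.hsDiameter σ N) (N + 1), Literature.MathematicalPhysics.KineticTheory.TendstoHydroFieldsAt (fun N => Literature.MathematicalPhysics.KineticTheory.localGibbsLaw σ a₀ u₀ θ₀ N (Φ N)) Φ ρ u θ 0 → 0 < T → ∀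 τ : ℝ, 0 < τ → ∀ φ : ℝ → Literature.MathematicalPhysics.KineticTheory.T3 → ℝ, Literature.Analysis.FunctionSpaces.Torus.IsSmoothSpaceTimeOn Set.univ φ → (∀ s x, 0 ≤ φ s x) → (∃ τ' : ℝ, τ' < τ ∧ ∀ s, τ' ≤ s → ∀ x, φ s x = 0) → ∀ η δ : ℝ, 0 < η → 0 < δ → ∃ r₀ : ℝ, 0 < r₀ ∧ ∀ r : ℝ, 0 < r → r < r₀ → ∃ N₀ : ℕ, ∀ N : ℕ, N₀ ≤ N → let γ : Literature.Analysis.FluidPDE.Config (N + 1) (Fin 3) Literature.MathematicalPhysics.KineticTheory.T3 → ℝ → Literature.Analysis.FluidPDE.Config (N + 1) (Fin 3) Literature.MathematicalPhysics.KineticTheory.T3 := fun z s => (Φ N).flow s z; let bx : Literature.MathematicalPhysics.KineticTheory.T3 → Literature.MathematicalPhysics.KineticTheory.T3 → ℝ := fun x y => 3 / (Real.pi * r ^ 3) * max (1 - Literature.Analysis.FluidPDE.Torus.euclidDist x y / r) 0; let ρm : Literature.Analysis.FluidPDE.Config (N + 1) (Fin 3) Literature.MathematicalPhysics.KineticTheory.T3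 → ℝ → Literature.MathematicalPhysics.KineticTheory.T3 → ℝ := fun z s x₀ => ∫ q, bx q.1 x₀ ∂(Literature.Analysis.FluidPDE.empiricalMeasure (γ z s)); let mm : Literature.Analysis.FluidPDE.Config (N + 1) (Fin 3) Literature.MathematicalPhysics.KineticTheory.T3 → ℝ → Literature.MathematicalPhysics.KineticTheory.T3 → Literature.MathematicalPhysics.KineticTheory.V3 := fun z s x₀ => ∫ q, bx q.1 x₀ • q.2 ∂(Literature.Analysis.FluidPDE.empiricalMeasure (γ z s)); let em : Literature.Analysis.FluidPDE.Config (N + 1) (Fin 3) Literature.MathematicalPhysics.KineticTheory.T3 → ℝ → Literature.MathematicalPhysics.KineticTheory.T3 → ℝ := fun z s x₀ => ∫ q, bx q.1 x₀ * (‖q.2‖ ^ 2 / 2) ∂(Literature.Analysis.FluidPDE.empiricalMeasure (γ z s)); let θm : Literature.Analysis.FluidPDE.Config (N + 1) (Fin 3) Literature.MathematicalPhysics.KineticTheory.T3 → ℝ → Literature.MathematicalPhysics.KineticTheory.T3 → ℝ := fun z s x₀ => 2 / 3 * (em z s x₀ / ρm z s x₀ - ‖mm z s x₀‖ ^ 2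 / (2 * ρm z s x₀ ^ 2)); let Hs : ℝ → ℝ → ℝ := fun a b => if 0 < a ∧ 0 < b then -(a * (3 / 2 * Real.log b - Real.log a - Literature.MathematicalPhysics.KineticTheory.hsExcessFreeEnergy (a * σ ^ 3))) else 0; let I : Literature.Analysis.FluidPDE.Config (N + 1) (Fin 3) Literature.MathematicalPhysics.KineticTheory.T3 → ℝ := fun z => ∫ s in Set.Icc (0 : ℝ) τ, ∫ x : Literature.MathematicalPhysics.KineticTheory.T3, Hs (ρm z s x) (θm z s x) * (deriv (fun s' => φ s' x) s + ∑ k : Fin 3, (mm z s x) k / ρm z s x * Literature.Analysis.FunctionSpaces.Torus.partialDeriv k (φ s) x); Literature.MathematicalPhysics.KineticTheory.localGibbsLaw σ a₀ u₀ θ₀ N (Φ N) {z | I z + ∫ x : Literature.MathematicalPhysics.KineticTheory.T3, Hs (ρ 0 x) (θ 0 x) * φ 0 x < -η} ≤ ENNReal.ofReal δ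

/-- item stmt-AtomisticToContinuum-13481 · crux · rank 9 · open · by planner
why it might fail: Needs the pair correlation AT CONTACT of the evolved law to take the local-equilibrium value Y(σ³ρ) along the flow — the positional Boltzmann–Enskog hypothesis at fixed σ; dynamic (ring/shielding) corrections of relative order φ out of equilibrium would shift the rate at Euler-visible order.
sources: VanbeijerenErnst1973, Resibois1978, Lachowicz1998, Soto2016, Spohn1991
[support] RATE / CONTACT-VALUE IDENTIFICATION (verbatim re-filing of stmt-AtomisticToContinuum-3988;
the positional half of the Enskog closure, not addressed by velocity-space percolation): ∃ universal
η₀ > 0, for σ < σ₀(profiles), local Gibbs data, every τ, χ and continuous cutoff g vanishing on [η₀,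
∞): K_N[χ·g(σ³ρ^N_r)] − σ³∫_0^τ∫χ g Y(σ³ρ^N_r) B¹_r dx ds → 0 in probability (N → ∞ then r → 0),
B¹_r = ∫∫π|v−w| (mollified μ⊗μ), Y = (3/2π)·hsExcessFreeEnergy′ the contact value. [difficulty:
open-problem] -/
@[route_item "route-AtomisticToContinuum-InformationPercolationEngine", crux]
def CollisionRate : Prop :=
  ∃ η₀ : ℝ, 0 < η₀ ∧ ∀ (a₀ θ₀ : Literature.MathematicalPhysics.KineticTheory.T3 → ℝ) (u₀ : Literature.MathematicalPhysics.KineticTheory.T3 → Literature.MathematicalPhysics.KineticTheory.V3), Continuous a₀ → Continuous θ₀ → Continuous u₀ → (∀ x, 0 < a₀ x) → (∀ x, 0 < θ₀ x) → ∃ σ₀ : ℝ, 0 < σ₀ ∧ ∀ σ : ℝ, 0 < σ → σ < σ₀ → ∀ Φ : (N : ℕ) → Literature.Analysis.FluidPDE.HardSphereFlow (Literature.Analysis.FluidPDE.Torus.geometry (Fin 3)) (Literature.MathematicalPhysics.KineticTheory.hsDiameter σ N) (N + 1), ∀ τ : ℝ, 0 < τ → ∀ χ : ℝ × Literature.MathematicalPhysics.KineticTheory.T3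 → ℝ, Continuous χ → ∀ g : ℝ → ℝ, Continuous g → (∀ a, η₀ ≤ a → g a = 0) → ∀ η δ : ℝ, 0 < η → 0 < δ → ∃ r₀ : ℝ, 0 < r₀ ∧ ∀ r : ℝ, 0 < r → r < r₀ → ∃ N₀ : ℕ, ∀ N : ℕ, N₀ ≤ N → let ε := Literature.MathematicalPhysics.KineticTheory.hsDiameter σ N; let G : Literature.Analysis.FluidPDE.Geometry (Fin 3) Literature.MathematicalPhysics.KineticTheory.T3 := Literature.Analysis.FluidPDE.Torus.geometry (Fin 3); let γ : Literature.Analysis.FluidPDE.Config (N + 1) (Fin 3) Literature.MathematicalPhysics.KineticTheory.T3 → ℝ → Literature.Analysis.FluidPDE.Config (N + 1) (Fin 3) Literature.MathematicalPhysics.KineticTheory.T3 := fun z s => (Φ N).flow s z; let bx : Literature.MathematicalPhysics.KineticTheory.T3 → Literature.MathematicalPhysics.KineticTheory.T3 → ℝ := fun x y => 3 / (Real.pi * r ^ 3) * max (1 - Literature.Analysis.FluidPDE.Torus.euclidDist x y / r) 0; let ρm : Literature.Analysis.FluidPDE.Config (N + 1) (Fin 3) Literature.MathematicalPhysics.KineticTheory.T3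 → ℝ → Literature.MathematicalPhysics.KineticTheory.T3 → ℝ := fun z s x₀ => ∫ q, bx q.1 x₀ ∂(Literature.Analysis.FluidPDE.empiricalMeasure (γ z s)); let B1 : Literature.Analysis.FluidPDE.Config (N + 1) (Fin 3) Literature.MathematicalPhysics.KineticTheory.T3 → ℝ → Literature.MathematicalPhysics.KineticTheory.T3 → ℝ := fun z s x₀ => ∫ p, bx p.1.1 x₀ * bx p.2.1 x₀ * (Real.pi * ‖p.1.2 - p.2.2‖) ∂((Literature.Analysis.FluidPDE.empiricalMeasure (γ z s)).prod (Literature.Analysis.FluidPDE.empiricalMeasure (γ z s))); let Kc : (Literature.Analysis.FluidPDE.Config (N + 1) (Fin 3) Literature.MathematicalPhysics.KineticTheory.T3 → ℝ → Fin (N + 1) → Fin (N + 1) → ℝ) → Literature.Analysis.FluidPDE.Config (N + 1) (Fin 3) Literature.MathematicalPhysics.KineticTheory.T3 → ℝ := fun F z => ε / (N + 1 : ℝ) * ∑ᶠ (s : ℝ) (_ : s ∈ Literature.Analysis.FluidPDE.collisionTimes G ε (γ z) ∩ Set.Icc 0 τ), ∑ i : Fin (N + 1), ∑ j : Fin (N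 + 1), (if i ≠ j ∧ ‖G.sepVec (γ z s i).1 (γ z s j).1‖ = ε then F z s i j else 0); let Y : ℝ → ℝ := fun a => 3 / (2 * Real.pi) * deriv Literature.MathematicalPhysics.KineticTheory.hsExcessFreeEnergy a; let D : Literature.Analysis.FluidPDE.Config (N + 1) (Fin 3) Literature.MathematicalPhysics.KineticTheory.T3 → ℝ := fun z => Kc (fun z s i _ => χ (s, (γ z s i).1) * g (σ ^ 3 * ρm z s (γ z s i).1)) z - σ ^ 3 * ∫ s in Set.Icc (0 : ℝ) τ, ∫ x : Literature.MathematicalPhysics.KineticTheory.T3, χ (s, x) * g (σ ^ 3 * ρm z s x) * Y (σ ^ 3 * ρm z s x) * B1 z s x; Literature.MathematicalPhysics.KineticTheory.localGibbsLaw σ a₀ u₀ θ₀ N (Φ N) {z | η < |D z|} ≤ ENNReal.ofReal δ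

/-- item stmt-AtomisticToContinuum-3091 · crux · rank 9 · open · by planner
why it might fail: Smooth implosions of 3-D compressible Euler (MerleEtAl2022, BuckmasterCaolaboraGomezserrano2025) have sup ρ_t → ∞ as t ↑ T*; if implosion from smooth positive data on 𝕋³ survives the O(σ³) hard-sphere EOS perturbation, ρ_tσ³ < η fails near T* at every fixed σ.
sources: Sideris1985, MerleEtAl2022, BuckmasterCaolaboraGomezserrano2025, Spohn1991, OllaVaradhanYau1993
[crux] (card crux 1B ∪ 3; the hidden PDE crux of every route) for every η > 0 and all continuous
positive profiles there is σ₀ > 0 such that for 0 < σ < σ₀, every classical hard-sphere-Euler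
solution on [0,T) whose t = 0 fields are the LLN limit of the local Gibbs laws satisfies ρ_t(x)σ³ <
η for all t < T and x — i.e. limsup_{σ→0} σ³ sup_{t<T*_σ} ‖ρ_σ(t)‖_∞ = 0 profile by profile. For
profiles whose ideal-gas development is global or breaks by a non-degenerate shock (Luk–Speck /
Buckmaster–Shkoller–Vicol open sets) this is stability of shock formation under an O(σ³)
equation-of-state and data perturbation; in general it is a σ-uniform density bound at the FIRST
singularity of 3-D compressible Euler for all smooth data. [deps: EosContinuity,
LocalGibbsDensityLimit] [difficulty: open-problem] -/
@[route_item "route-AtomisticToContinuum-InformationPercolationEngine"]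
def DiluteSelfConsistency : Prop :=
  ∀ η : ℝ, 0 < η → ∀ (a₀ θ₀ : Literature.MathematicalPhysics.KineticTheory.T3 → ℝ) (u₀ : Literature.MathematicalPhysics.KineticTheory.T3 → Literature.MathematicalPhysics.KineticTheory.V3), Continuous a₀ → Continuous θ₀ → Continuous u₀ → (∀ x, 0 < a₀ x) → (∀ x, 0 < θ₀ x) → ∃ σ₀ : ℝ, 0 < σ₀ ∧ ∀ σ : ℝ, 0 < σ → σ < σ₀ → ∀ (T : ℝ) (ρ θ : ℝ → Literature.MathematicalPhysics.KineticTheory.T3 → ℝ) (u : ℝ → Literature.MathematicalPhysics.KineticTheory.T3 → Literature.MathematicalPhysics.KineticTheory.V3), Literature.MathematicalPhysics.KineticTheory.IsHardSphereEulerSolution σ T ρ u θ → ∀ Φ : (N : ℕ) → Literature.Analysis.FluidPDE.HardSphereFlow (Literature.Analysis.FluidPDE.Torus.geometry (Fin 3)) (Literature.MathematicalPhysics.KineticTheory.hsDiameter σ N) (N + 1), Literature.MathematicalPhysics.KineticTheory.TendstoHydroFieldsAt (fun N => Literature.MathematicalPhysics.KineticTheory.localGibbsLaw σ a₀ u₀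 θ₀ N (Φ N)) Φ ρ u θ 0 → ∀ t ∈ Set.Ico 0 T, ∀ x, ρ t x * σ ^ 3 < η

/-- item stmt-AtomisticToContinuum-15141 · crux · rank 10 · open · by planner
why it might fail: Maxwellian rigidity for measure-valued limits with vacuum/cold regions; BF18 for the hs EOS fed with r-mollified in-probability admissibility (LocalSecondLaw's format) instead of its renormalised inequality is unprinted; the density-cap bootstrap needs the cap slightly past the converged interval.
sources: BrezinaFeireisl2018, BrezinaFeireisl2018Revisited, Bogolyubov1975, arXiv:1504.03215, Wiedemann2018, Resibois1978
[crux] CHAOS CLOSES EULER IN THE PACKING BAND — the kinetic dock, restated at rev 8 (replaces the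
support KineticClosure stmt-13482, dropped after FOUR independent prover verdicts 'refuted-misstated
/ not closable as filed': its antecedents carried no velocity-tail control;
evidence-13482-kinetic-closure-gap.md, -gen1.md, -gen2.md, -gen3.md, KineticClosureGen2/3.lean):
ContactChaos → CollisionRate → LocalSecondLaw → HydroLimitInBand, the conclusion being VERBATIM the
shared packing-guarded conjunct stmt-9133 (∃η₀>0: for classical hs-Euler solutions with ρσ³ < η₀ on
[0,T) tied to local Gibbs data by the t = 0 LLN, the empirical fields converge in probability at
every t < T; crux of ImplosionDichotomy, target of EulerCharacteristics) — so that
DiluteSelfConsistency enters only in `closes` (guard removal, profile by profile) and the PROVED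
HsEosLowDensity (stmt-0768, `HsEosLowDensity_holds` / `hsEosLowDensity_proof`) is used, not assumed.
Ledger rank 10 (= last; the route's seventh crux): by hardness it sits below every open-problem crux
(size L) and it must render after the cruxes it quotes whatever ranks the re-badged ones carry.
SPLIT (D-0019 layer 2, filed with rev 8): children Co -/
@[route_item "route-AtomisticToContinuum-InformationPercolationEngine", crux]
def ChaosClosesEuler : Prop :=
  ContactChaos → CollisionRate → LocalSecondLaw → ∃ η₀ : ℝ, 0 < η₀ ∧ ∀ (a₀ θ₀ : Literature.MathematicalPhysics.KineticTheory.T3 → ℝ) (u₀ : Literature.MathematicalPhysics.KineticTheory.T3 → Literature.MathematicalPhysics.KineticTheory.V3), Continuous a₀ → Continuous θ₀ → Continuous u₀ → (∀ x, 0 < a₀ x) → (∀ x, 0 < θ₀ x) → ∃ σ₀ : ℝ, 0 < σ₀ ∧ ∀ σ : ℝ, 0 < σ → σ < σ₀ → ∀ (T : ℝ) (ρ θ : ℝ → Literature.MathematicalPhysics.KineticTheory.T3 → ℝ) (u : ℝ → Literature.MathematicalPhysics.KineticTheory.T3 → Literature.MathematicalPhysics.KineticTheory.V3), Literature.MathematicalPhysics.KineticTheory.IsHardSphereEulerSolution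 σ T ρ u θ → (∀ t ∈ Set.Ico 0 T, ∀ x, ρ t x * σ ^ 3 < η₀) → ∀ Φ : (N : ℕ) → Literature.Analysis.FluidPDE.HardSphereFlow (Literature.Analysis.FluidPDE.Torus.geometry (Fin 3)) (Literature.MathematicalPhysics.KineticTheory.hsDiameter σ N) (N + 1), Literature.MathematicalPhysics.KineticTheory.TendstoHydroFieldsAt (fun N => Literature.MathematicalPhysics.KineticTheory.localGibbsLaw σ a₀ u₀ θ₀ N (Φ N)) Φ ρ u θ 0 → ∀ t ∈ Set.Ico 0 T, Literature.MathematicalPhysics.KineticTheory.TendstoHydroFieldsAt (fun N => Literature.MathematicalPhysics.KineticTheory.localGibbsLaw σ a₀ u₀ θ₀ N (Φ N)) Φ ρ u θ t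

/-- item stmt-AtomisticToContinuum-0768 · support · rank 9 · closed · proved by Summit.AtomisticToContinuum.HydrodynamicLimit.Theorems.hsEosLowDensity_proof (prover) · by planner
sources: Ruelle1969, LebowitzPenrose1964
[support] Hard-sphere equation of state at low density: ∃ η₀ > 0 and F real-analytic on (−η₀, η₀)
with hsExcessFreeEnergy = F on [0, η₀), F(0) = 0, F'(0) = 2π/3 (second virial coefficient of
unit-diameter spheres), and the canonical thermodynamic limit −N⁻¹ log hsFreeVolume η N → F(η)
exists (not just limsup) for η ∈ [0, η₀). Ruelle1969 §3.4 (existence), LebowitzPenrose1964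
(convergence of the virial expansion ⇒ analyticity). Makes hsCompressibility/hsPressure smooth and
Z(η) = 1 + (2π/3)η + O(η²); needed by every route (hyperbolicity of the Euler system, virial
theorem). -/
@[route_item "route-AtomisticToContinuum-InformationPercolationEngine"]
def HsEosLowDensity : Prop :=
  ∃ η₀ : ℝ, 0 < η₀ ∧ ∃ F : ℝ → ℝ, AnalyticOnNhd ℝ F (Set.Ioo (-η₀) η₀) ∧ Set.EqOn Literature.MathematicalPhysics.KineticTheory.hsExcessFreeEnergy F (Set.Ico 0 η₀) ∧ F 0 = 0 ∧ deriv F 0 = 2 * Real.pi / 3 ∧ ∀ η ∈ Set.Ico 0 η₀, Filter.Tendsto (fun N : ℕ => -(N : ℝ)⁻¹ * Real.log (Literature.MathematicalPhysics.KineticTheory.hsFreeVolume η N)) Filter.atTop (nhds (F η))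

/-- `HsEosLowDensity` holds: proved by `Summit.AtomisticToContinuum.HydrodynamicLimit.Theorems.hsEosLowDensity_proof`. -/
theorem HsEosLowDensity_holds : HsEosLowDensity := _root_.Summit.AtomisticToContinuum.HydrodynamicLimit.Theorems.hsEosLowDensity_proof

/-- item stmt-AtomisticToContinuum-13082 · support · rank 9 · open · by planner
sources: Spohn1991, OllaVaradhanYau1993
[crux] (re-ask of stmt-3990 verbatim) no overcompression before the shock: under the conjunct's
hypotheses, for every t < T and η > 0, P(∃ s ≤ t, ∃ x: ρ^N_r(s,x) > ρ(s,x) + η) → 0 as N → ∞ then r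
→ 0 (ρ the classical Euler density). Keeps the cutoffs g of OddContactSymmetry / EvenStressEnskog
inactive before T and forbids spatial concentration of mass in the r → 0 passage to local laws.
[difficulty: L] -/
@[route_item "route-AtomisticToContinuum-InformationPercolationEngine"]
def DensityCap : Prop :=
  ∀ (a₀ θ₀ : Literature.MathematicalPhysics.KineticTheory.T3 → ℝ) (u₀ : Literature.MathematicalPhysics.KineticTheory.T3 → Literature.MathematicalPhysics.KineticTheory.V3), Continuous a₀ → Continuous θ₀ → Continuous u₀ → (∀ x, 0 < a₀ x) → (∀ x, 0 < θ₀ x) → ∃ σ₀ : ℝ, 0 < σ₀ ∧ ∀ σ : ℝ, 0 < σ → σ < σ₀ → ∀ (T : ℝ) (ρ θ : ℝ → Literature.MathematicalPhysics.KineticTheory.T3 → ℝ) (u : ℝ → Literature.MathematicalPhysics.KineticTheory.T3 → Literature.MathematicalPhysics.KineticTheory.V3), Literature.MathematicalPhysics.KineticTheory.IsHardSphereEulerSolution σ T ρ u θ → ∀ Φ : (N : ℕ) → Literature.Analysis.FluidPDE.HardSphereFlow (Literature.Analysis.FluidPDE.Torus.geometry (Fin 3)) (Literature.MathematicalPhysics.KineticTheory.hsDiameter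 σ N) (N + 1), Literature.MathematicalPhysics.KineticTheory.TendstoHydroFieldsAt (fun N => Literature.MathematicalPhysics.KineticTheory.localGibbsLaw σ a₀ u₀ θ₀ N (Φ N)) Φ ρ u θ 0 → ∀ t ∈ Set.Ico 0 T, ∀ η δ : ℝ, 0 < η → 0 < δ → ∃ r₀ : ℝ, 0 < r₀ ∧ ∀ r : ℝ, 0 < r → r < r₀ → ∃ N₀ : ℕ, ∀ N : ℕ, N₀ ≤ N → let γ : Literature.Analysis.FluidPDE.Config (N + 1) (Fin 3) Literature.MathematicalPhysics.KineticTheory.T3 → ℝ → Literature.Analysis.FluidPDE.Config (N + 1) (Fin 3) Literature.MathematicalPhysics.KineticTheory.T3 := fun z s => (Φ N).flow s z; let bx : Literature.MathematicalPhysics.KineticTheory.T3 → Literature.MathematicalPhysics.KineticTheory.T3 → ℝ := fun x y => 3 / (Real.pi * r ^ 3) * max (1 - Literature.Analysis.FluidPDE.Torus.euclidDist x y / r) 0; let ρm : Literature.Analysis.FluidPDE.Config (N + 1) (Fin 3) Literature.MathematicalPhysics.KineticTheory.T3 → ℝ → Literature.MathematicalPhysics.KineticTheory.T3 → ℝ :=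 fun z s x₀ => ∫ q, bx q.1 x₀ ∂(Literature.Analysis.FluidPDE.empiricalMeasure (γ z s)); Literature.MathematicalPhysics.KineticTheory.localGibbsLaw σ a₀ u₀ θ₀ N (Φ N) {z | ∃ s ∈ Set.Icc 0 t, ∃ x : Literature.MathematicalPhysics.KineticTheory.T3, ρ s x + η < ρm z s x} ≤ ENNReal.ofReal δ

/-- item stmt-AtomisticToContinuum-15144 · support · rank 9 · open · by planner
why it might fail: Only Σ|v|² is conserved and a collision functional weights fast pairs by their rate ∝ |v−v*| (third moments along the TRUE flow); equilibrium gives the mean, but transfer to local Gibbs data needs a speed-N deviation bound for an N^{4/3}-term collision sum, unprinted at fixed σ (HighMomentumCutoff).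
sources: OllaVaradhanYau1993, Spohn1991, KipnisLandim1999, GST2013, CIP1994, Literature.Barriers.AtomisticToContinuum.HighMomentumCutoffBarrierNarrow
[support] SECOND VELOCITY MOMENTS OF THE EMPIRICAL COLLISION FUNCTIONAL ARE TIGHT (rev 10; filed as
SUPPORT because a planner-side --split of ChaosClosesEuler is final-cycle-only — it is the foreseen
layer-2 child / first stub of that crux and NOT routine: why it might fail — only Σ|v|² is conserved
and a collision functional weights fast pairs by their rate ∝ |v−v*|, third moments along the TRUE
flow; the transfer to local Gibbs data needs a speed-N deviation bound for an N^{4/3}-term collision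
sum, unprinted at fixed σ, HighMomentumCutoff class; the velocity-tail input of the kinetic closure,
typed over the same normalised collision functional K_N = (ε/(N+1)) Σ_{collision times ≤ τ}
Σ_{ordered contact pairs} as ContactChaos / CollisionRate): for continuous positive profiles ∃σ₀
∀σ<σ₀ ∀ flow families Φ ∀τ>0 ∀δ>0 ∃K_b ∃N₀ ∀N≥N₀: P_LG( K_N[1 + |v_i|² + |v_j|²] > K_b ) ≤ δ,
velocities read at the collision instant (the mark is collision-invariant, so pre/post is
immaterial). Content: tightness of the normalised collision COUNT K_N[1] (≍ σ³τ × Enskog rate in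
equilibrium) and uniform integrability of the momentum-transfer mark |(v−v*)·ω| ≤ |v−v*| against K_N
(K_N[|v−v*|·1_{|v−v*|>L}] ≤ -/
@[route_item "route-AtomisticToContinuum-InformationPercolationEngine", crux]
def CollisionMomentBound : Prop :=
  ∀ (a₀ θ₀ : Literature.MathematicalPhysics.KineticTheory.T3 → ℝ) (u₀ : Literature.MathematicalPhysics.KineticTheory.T3 → Literature.MathematicalPhysics.KineticTheory.V3), Continuous a₀ → Continuous θ₀ → Continuous u₀ → (∀ x, 0 < a₀ x) → (∀ x, 0 < θ₀ x) → ∃ σ₀ : ℝ, 0 < σ₀ ∧ ∀ σ : ℝ, 0 < σ → σ < σ₀ → ∀ Φ : (N : ℕ) → Literature.Analysis.FluidPDE.HardSphereFlow (Literature.Analysis.FluidPDE.Torus.geometry (Fin 3)) (Literature.MathematicalPhysics.KineticTheory.hsDiameter σ N) (N + 1), ∀ τ : ℝ, 0 < τ → ∀ δ : ℝ, 0 < δ → ∃ Kb : ℝ, ∃ N₀ : ℕ, ∀ N : ℕ, N₀ ≤ N → let ε := Literature.MathematicalPhysics.KineticTheory.hsDiameter σ N; let G : Literature.Analysis.FluidPDE.Geometry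 (Fin 3) Literature.MathematicalPhysics.KineticTheory.T3 := Literature.Analysis.FluidPDE.Torus.geometry (Fin 3); let γ : Literature.Analysis.FluidPDE.Config (N + 1) (Fin 3) Literature.MathematicalPhysics.KineticTheory.T3 → ℝ → Literature.Analysis.FluidPDE.Config (N + 1) (Fin 3) Literature.MathematicalPhysics.KineticTheory.T3 := fun z s => (Φ N).flow s z; let Kc : (Literature.Analysis.FluidPDE.Config (N + 1) (Fin 3) Literature.MathematicalPhysics.KineticTheory.T3 → ℝ → Fin (N + 1) → Fin (N + 1) → ℝ) → Literature.Analysis.FluidPDE.Config (N + 1) (Fin 3) Literature.MathematicalPhysics.KineticTheory.T3 → ℝ := fun F z => ε / (N + 1 : ℝ) * ∑ᶠ (s : ℝ) (_ : s ∈ Literature.Analysis.FluidPDE.collisionTimes G ε (γ z) ∩ Set.Icc 0 τ), ∑ i : Fin (N + 1), ∑ j : Fin (N + 1), (if i ≠ j ∧ ‖G.sepVec (γ z s i).1 (γ z s j).1‖ = ε then F z s i j else 0); Literature.MathematicalPhysics.KineticTheory.localGibbsLaw σ a₀ u₀ θ₀ N (Φ N) {z | Kb < Kc (fun z s i j =>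 1 + ‖(γ z s i).2‖ ^ 2 + ‖(γ z s j).2‖ ^ 2) z} ≤ ENNReal.ofReal δ

-- earlier Assembly (stmt-AtomisticToContinuum-13483, replaced 2026-08-15T23:02:00Z -> stmt-AtomisticToContinuum-13918): retired by None — KickIsotropyInfo → SpectralContraction → PercolationClosesChaos → CollisionRate → LocalSecondLaw → DensityCap → HsEosLowDensity → DiluteSelfConsistency → KineticClosure → HydrodynamicLimit
-- earlier Assembly (stmt-AtomisticToContinuum-13918, replaced 2026-08-16T06:46:54Z -> stmt-AtomisticToContinuum-14916): proved by Summit.AtomisticToContinuum.HydrodynamicLimit.Theorems.Assembly_proof @ d40345d45b7c — KickIsotropyInfo → SpectralContractionR → PercolationClosesChaos → CollisionRate → LocalSecondLaw → DensityCap → HsEosLowDensity → DiluteSelfConsistency → KineticClosure → HydrodynamicL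
-- earlier Assembly (stmt-AtomisticToContinuum-14916, replaced 2026-08-16T08:32:26Z -> stmt-AtomisticToContinuum-15140): retired by None — KickFairRelEquilibrium → SpectralContractionR → PercolationClosesChaos → CollisionRate → LocalSecondLaw → DensityCap → HsEosLowDensity → DiluteSelfConsistency → KineticClosure → HydrodynamicLimit
-- earlier Assembly (stmt-AtomisticToContinuum-15140, replaced 2026-08-16T12:31:18Z -> stmt-AtomisticToContinuum-15179): proved by Summit.AtomisticToContinuum.HydrodynamicLimit.Theorems.informationPercolationEngine_assembly_rev8_proof @ 0c2bc2a375dc — KickFairRelEquilibrium → SpectralContractionR → PercolationClosesChaos → CollisionRate → LocalSecondLaw → ChaosClosesEuler → DiluteSelfConsistency → Hy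
-- earlier Assembly (stmt-AtomisticToContinuum-15179, replaced 2026-08-16T23:23:17Z -> stmt-AtomisticToContinuum-17601): proved by Summit.AtomisticToContinuum.HydrodynamicLimit.Theorems.informationPercolationEngine_assembly_rev8_proof — KickFairRelEquilibriumMeso → SpectralContractionR → PercolationClosesChaos → CollisionRate → LocalSecondLaw → ChaosClosesEuler → DiluteSelfConsistency → HydrodynamicL
-- earlier Assembly (stmt-AtomisticToContinuum-17601, replaced 2026-08-16T23:42:18Z -> stmt-AtomisticToContinuum-17869): retired by None — KickFairRelEquilibriumMeso → SpectralContractionR → PercolationClosesChaos → CollisionRate → LocalSecondLaw → ChaosClosesEuler → HydrodynamicLimit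
/-- item stmt-AtomisticToContinuum-17869 · assembly · rank 1 · open · by planner
sources: PolyanskiyWu2017, Spohn1991, BrezinaFeireisl2018
[assembly] frame statement #1 of the thesis, X → Statement, with X the Lean line of the `closes`
chain MINUS the dock: KickFairRelEquilibriumMeso → SpectralContractionR → PercolationClosesChaos →
CollisionRate → LocalSecondLaw → HydrodynamicLimit (the packing-guarded conjunct, the sub-problem
decl itself since the re-type p126922) — engine inputs + Enskog rate + admissibility ⇒ Euler in the
packing band. Implied by the dock crux ChaosClosesEuler by one line of logic (`fun hK hS hP hR hL =>
hC (hP hK hS) hR hL`; farm-checked as `assemblyR_of_dock` in the rev-16 planner's Sketch.lean) and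
provable the moment the dock is; NOT a hypothesis of `closes` (crux-only). Rev 16 restatement
(route-repair, ground-failed) of the rev-15 Assembly stmt-AtomisticToContinuum-17601, which carried
ChaosClosesEuler itself as a sixth antecedent and was therefore a tautology closed by the ground
battery (`intros; aesop`, ground.trivial — the route's one blocking flag); the new statement is
battery-clean (same `#h21_ground` tactics, no flag). Sibling pattern: JParityClosure Assembly
stmt-17595 (uncurried twin of ParityBandClosure), OneFlightGossipEngine Assembly stmt-17616 (thesis
line minus ClampedTransfe -/
@[route_item "route-AtomisticToContinuum-InformationPercolationEngine"]
def Assembly : Prop :=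
  KickFairRelEquilibriumMeso → SpectralContractionR → PercolationClosesChaos → CollisionRate → LocalSecondLaw → _root_.HydrodynamicLimit

-- records of items no longer active in this route (dropped / restated):
-- earlier KickIsotropyInfo (stmt-AtomisticToContinuum-13478, replaced 2026-08-16T06:46:54Z -> stmt-AtomisticToContinuum-14914): retired by None — ∀ (a₀ θ₀ : Literature.MathematicalPhysics.KineticTheory.T3 → ℝ) (u₀ : Literature.MathematicalPhysics.KineticTheory.T3 → Literature.MathematicalPhysics.KineticTheory.V3), Continuous a₀ → Continuous θ₀ → Continuous u₀ → (∀ x, 0 < a₀ x) → (∀ x, 0 < θ₀ x) → ∃ 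
-- earlier SpectralContraction (stmt-AtomisticToContinuum-13479, replaced 2026-08-15T23:02:00Z -> stmt-AtomisticToContinuum-13913): refuted by Summit.AtomisticToContinuum.HydrodynamicLimit.Theorems.InformationPercolationEngineSpectralContraction_refuted @ 1aef2ab59ca9 — ∃ c : ℝ, c < 1 / 2 ∧ let M : Literature.MathematicalPhysics.KineticTheory.V3 → ℝ := Literature.Analysis.FluidPDE.globalMaxwellian; l
-- earlier KickFairRelEquilibrium (stmt-AtomisticToContinuum-14914, replaced 2026-08-16T12:31:18Z -> stmt-AtomisticToContinuum-15177): retired by None — ∀ (a₀ θ₀ : Literature.MathematicalPhysics.KineticTheory.T3 → ℝ) (u₀ : Literature.MathematicalPhysics.KineticTheory.T3 → Literature.MathematicalPhysics.KineticTheory.V3), Continuous a₀ → Continuous θ₀ → Continuous u₀ → (∀ x, 0 < a₀ x) → (∀ x, 0 < θ₀ x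

/-! D-0027 §2.1 — DECIDING THEOREM (planner-authored via `route open/edit --closes-file`; by planner-rrepair-AtomisticToContinuum-Informati-19755f69-0 2026-08-16T23:23:17Z):
its hypotheses are this route's items and its conclusion the sub-problem Statement (glue_lint), and it elaborates with this file. -/

/-- D-0027 §2.1 deciding theorem (route InformationPercolationEngine, card information-percolation-collision-dag; rev 15 =
statement re-type hydro2, p126922, 2026-08-16: the sub-problem decl `_root_.HydrodynamicLimit` is now the PACKING-GUARDED
conjunct, verbatim the conclusion of the kinetic dock ChaosClosesEuler). Every hypothesis is a ranked CRUX of this route.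
PercolationClosesChaos applied to KickFairRelEquilibriumMeso and SpectralContractionR yields the target ContactChaos
(derived, not assumed); ChaosClosesEuler fed with ContactChaos, CollisionRate and LocalSecondLaw IS the guarded conjunct
`∃ η₀ > 0, ∀ profiles, ∃ σ₀ > 0, ∀ σ < σ₀, ∀ T, ∀ classical hs-Euler solutions with ρσ³ < η₀ on [0,T), …` — the packing
guard is supplied by the dock's own threshold η₀, so the former seventh hypothesis DiluteSelfConsistency (guard removal
for the unguarded pre-retype conjunct) is no longer consumed and is dropped from this route. The proved support
HsEosLowDensity is consumed inside ChaosClosesEuler's proof (via its split children), not here. -/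
@[closes "route-AtomisticToContinuum-InformationPercolationEngine"] theorem closes (hK : KickFairRelEquilibriumMeso) (hS : SpectralContractionR) (hP : PercolationClosesChaos)
    (hR : CollisionRate) (hL : LocalSecondLaw) (hC : ChaosClosesEuler) :
    _root_.HydrodynamicLimit :=
  hC (hP hK hS) hR hL

end Summit.AtomisticToContinuum.HydrodynamicLimit.Theses.InformationPercolationEngine
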